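import Literature.MathematicalPhysics.QuantumLattice.HeisenbergOrderMerminWagnerGaugeProofs
import Literature.MathematicalPhysics.QuantumLattice.HeisenbergOrderMerminWagnerMagnetisationProofs
import Literature.MathematicalPhysics.QuantumLattice.HubbardHubbardModelKomaTasakiProofs
import Literature.MathematicalPhysics.QuantumLattice.HubbardHubbardModelProofs
import Literature.MathematicalPhysics.QuantumLattice.XYOrderThermalProofs
import Literature.Barriers.AtomisticToContinuum.HalfFillingDischarges
import Literature.Barriers.AtomisticToContinuum.HalfFillingReflectionPositivityProofs
import Literature.Barriers.HubbardSuperconductivity.HohenbergMerminWagnerPairing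
import Literature.Probability.LatticeModels.TorusTwoPointDecay
import Literature.MathematicalPhysics.QuantumLattice.SpinTorusLimitStates
import HarnessLib

/-!
# Decay of planar spin correlations at `T > 0` in `d ≤ 2` for quantum spin systems with only AXIAL
# (`U(1)`) symmetry: the XXZ model in axial fields, the quantum XY model, and the hard-core lattice
# Bose gas (no off-diagonal long-range order in `d ≤ 2` at any `T > 0`)

Topic `MathematicalPhysics/QuantumLattice`. Koma–Tasaki, PRL **68** (1992) 3248, prove power-law
(`d = 2`) resp. exponential (`d = 1`) decay of correlations at `T > 0` by the McBryan–Spencer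
complex rotation (imaginary gauge); their bound (4), `|⟨S¹_xS¹_y + S²_xS²_y⟩| ≤ |x - y|^{-α f(β)}`
"if the local field has the form `h_x = (0,0,h_x)`", and their note [11]: "one can prove the bound
(4) (and the corresponding bound in one dimension) for a large class of quantum spin systems with
short range interaction which is invariant under the global rotation about the `z`-axis. Our
method, of course, applies to quantum spin systems". The tree formalises this route for
interactions with the FULL rotation symmetry (`HeisenbergOrderMerminWagner{Gauge,Torus,}Proofs`:
`LatticeInteraction.IsRotationInvariant`) and for Hubbard electrons
(`HubbardHubbardModelKomaTasakiProofs`). This file supplies the AXIALLY symmetric case of note [11]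
— the only symmetry the method uses — for the concrete class

  `H = xxzHamiltonian n G J Δ + D = J Σ_{⟨x,y⟩} (S¹_xS¹_y + S²_xS²_y + Δ S³_xS³_y) + D`,

any spin `S = n/2`, any anisotropy `Δ`, and any Hermitian `D` FIXED by the imaginary gauge
`W_ψ = exp[-Σ_u ψ_u N_u]` (every function of the `S³_u`: uniform or staggered axial fields, Ising
couplings, constants; `gauge_conj_axialField`). Worked instances: the quantum XY model
`xyTorus d L n` (`J = -1`, `Δ = 0`, `D = 0`) and the hard-core lattice Bose gas at half filling in
the staggered ("optical lattice") potential of Aizenman–Lieb–Seiringer–Solovej–Yngvason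
(`hardCoreLatticeGas d L λ = xyTorus d L 1 + λ Σ_x [½ + (-1)^x S³_x]`); an XXZ model in a uniform or
staggered axial field is covered by the general statements with `D` the field term.

## Contents (all THEOREMS; no definition, no named fact)

* §0 algebra of Koma–Tasaki's perturbation map `P_W(B) = ½(W B W⁻¹ + (W B W⁻¹)ᴴ) - B` (additive,
  real-homogeneous, zero on Hermitian gauge-fixed operators); the gauge fixes axial fields
  `Σ_x (a_x 𝟙 + b_x S³_x)` (`gauge_conj_axialField`).
* §1 **one XXZ bond in closed form** (eqs. (7)–(9)): `P_ψ(B⁰_{xy} + B¹_{xy} + Δ B²_{xy}) =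
  (cosh (ψ_x - ψ_y) - 1)(B⁰_{xy} + B¹_{xy})` — the Ising part and the anisotropy drop out
  (`hermitianPart_gauge_xxzBond_sub`), norm `≤ ‖Ŝ⁺‖² (cosh (ψ_x - ψ_y) - 1)`.
* §2 **eq. (11) on any finite graph**: `‖P_ψ(xxzHamiltonian n G J Δ + D)‖ ≤
  |J| ‖Ŝ⁺‖² Σ_u Σ_v [u ∼ v] (cosh (ψ_u - ψ_v) - 1)`, uniformly in `Δ` and in the axial part `D`
  (`norm_hermitianPart_gauge_xxz_sub_le`, `norm_hermitianPart_gauge_xxz_add_sub_le`).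
* §3 **eqs. (6), (10)–(12) on the torus**: for a gauge eigen-operator `W A W⁻¹ = a A`,
  `|⟨A⟩_{β,L}| ≤ |a| ‖A‖ exp [β |J| ‖Ŝ⁺‖² Σ_u Σ_v [u ∼ v] (cosh (ψ_u - ψ_v) - 1)]`, by the tree's
  model-independent trace inequality `koma_tasaki_trace_bound` (`norm_gibbsState_xxzTorus_le`).
* §4 **bound (4) of the source for the axial class in `d = 2`, with an explicit exponent**
  (`abs_xxz_planarCorr_le_rpow_two`): for every `β ≥ 0`, every side `L ≥ 1`, every Hermitian
  gauge-fixed `D` and all sites,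
  `|Re ⟨S¹_xS¹_y⟩_{β,L} + Re ⟨S²_xS²_y⟩_{β,L}| ≤ 2‖Ŝ⁺‖² √e · (dist(x,y) + 1)^{-q/2}`,
  `q = 1/(128 β |J| ‖Ŝ⁺‖² + 1)` — uniform in `L`, `Δ`, `D` ("`f(β) ≈ 1/β` for `β ≫ δ`", p. 2 of the
  source), by the logarithmic McBryan–Spencer profile of the tree (`exists_testFunction_two`);
  **the one-dimensional case, EXPONENTIAL decay** (`abs_xxz_planarCorr_le_exp_one`): on the ring
  `ℤ/Lℤ`, `|Re ⟨S¹_xS¹_y⟩ + Re ⟨S²_xS²_y⟩| ≤ 2‖Ŝ⁺‖² exp (-dist(x,y)/ξ)` with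
  `ξ = 2(16 β|J|‖Ŝ⁺‖² + 1)`, by the tree's linear profile `exists_testFunction_one`; both packaged as
  a uniform power law for `d ∈ {1,2}` (`exists_abs_xxz_planarCorr_le_rpow`).
* §5 **no planar long-range order at `T > 0` in `d ≤ 2`**: the even-torus form of the tree's
  summation lemmas (`not_hasEvenTorusLRO_of_abs_le_rpow`, from
  `not_hasLongRangeOrder_subseq_of_abs_le_rpow`; the all-`L` form is
  `not_hasTorusLRO_of_abs_le_rpow`), and the instances: the quantum XY model —
  `xy_thermal_exists_abs_corr_le_rpow`, **`xy_thermal_not_hasTorusLRO`**,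
  **`xy_thermal_not_hasEvenTorusLRO`** (`d ∈ {1,2}`, every spin, every `β ≥ 0`; the complement of
  the tree's `kennedy_lieb_shastry_xy_thermal_holds`, `d ≥ 3`); the hard-core lattice gas —
  **`hardCoreLatticeGas_odlro_abs_le_rpow_two`** (`d = 2`: `|γ(x,y)| ≤ 2√e (dist+1)^{-1/(2(128β+1))}`,
  every `λ`, every `β ≥ 0`), `hardCoreLatticeGas_odlro_abs_le_exp_one` (`d = 1`),
  `hardCoreLatticeGas_exists_odlro_abs_le_rpow` (`d ∈ {1,2}`),
  **`hardCoreLatticeGas_not_hasTorusLRO`**, **`hardCoreLatticeGas_not_hasEvenTorusLRO`**: no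
  off-diagonal long-range order of hard-core lattice bosons in `d ≤ 2` at any temperature `T > 0`
  and any staggered field — the complement of Theorem 1 of Aizenman et al.
  (`HalfFillingReflectionPositivity`, `d ≥ 3`).
* §6 **no macroscopic eigenvalue of the one-particle density matrix** (Penrose–Onsager form, by
  the Schur test on the decay bound): `hardCoreLatticeGas_odlro_quadForm_eventually_le` — for
  `d ∈ {1,2}`, every `λ`, `β ≥ 0`, `ε > 0`, eventually in `L`, `|⟨φ, γ φ⟩| ≤ ε |Λ_L| ‖φ‖²` for every
  real `φ` (no condensation into ANY one-particle mode); `xy_thermal_quadForm_eventually_le`.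
* §7 the same at ANY filling: `hardCoreLatticeGas d L λ + μ Σ_x S³_x` (chemical potential = axial
  term): `hardCoreLatticeGas_chemPot_planarCorr_abs_le_rpow_two` (`d = 2`, uniform in `L, λ, μ`),
  `hardCoreLatticeGas_chemPot_quadForm_eventually_le` (`d ∈ {1,2}`: no macroscopic eigenvalue,
  `L₀` uniform in `μ`) — in `d ≤ 2` at `T > 0` there is nothing for half filling to protect.
* §8 the dimension dichotomy `hardCoreLatticeGas_hasEvenTorusLRO_iff_three_le`: for every `d ≥ 1`
  there is `λ₀ > 0` such that for `0 ≤ λ < λ₀` and all large `β`, `HasEvenTorusLRO (γ_{β,·,λ}) ↔ 3 ≤ d`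
  (the tree's reflection-positivity floor `HalfFillingReflectionPositivity_holds` for `d ≥ 3`, §5
  for `d ≤ 2`); `xy_thermal_eventually_hasEvenTorusLRO_iff_three_le`: for every `d ≥ 1` and spin
  `n/2 ≥ 1/2`, (planar LRO of `xyTorus` for all large `β`) `↔ 3 ≤ d`
  (`kennedy_lieb_shastry_xy_thermal_holds` × §5).
* §9 master Penrose–Onsager statement for the whole axial class, uniform in the axial part `D`:
  `xxz_planarCorr_quadForm_eventually_le`.
* §10 **the bounds in infinite volume, as printed** (`⟨A⟩ = lim_L ⟨A⟩_L`, eq. (3) of the source;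
  the tree's torus-limit states `InfVolState.IsTorusLimitOf`): `abs_xxz_planarCorr_torusLimit_le_rpow_two`
  (`d = 2`: `|Re ω(ŜˣₓŜˣ_y) + Re ω(ŜʸₓŜʸ_y)| ≤ 2‖Ŝ⁺‖²√e (‖x-y‖_∞+1)^{-q/2}` for EVERY torus-limit state
  of the Gibbs states of the axial class), `abs_xxz_planarCorr_torusLimit_le_exp_one` (`d = 1`),
  `hardCoreLatticeGas_odlro_torusLimit_abs_le_rpow_two` (planar hard-core bosons: `γ(x,y) → 0`),
  `xy_thermal_torusLimit_abs_corr_le_rpow_two` / `_le_exp_one` (quantum XY model, every spin),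
  `hardCoreLatticeGas_odlro_torusLimit_abs_le_exp_one` (hard-core bosons on the infinite chain).

Scope / what is NOT claimed: ground states (`β = ∞`; in `d = 2` the XY / hard-core boson ground
state HAS planar order, `kennedy_lieb_shastry_xy_ground_holds`), the `|ln β|` high-temperature
improvement of the source's `f(β)` (one admissible charge is used, as in the tree), correlations
of `S³` (not controlled by the axial symmetry), and optimal constants. The staggered potential,
the anisotropy and the fields enter neither the exponents nor the prefactors: only the planar
hopping `|J|` is "seen" by the gauge (the source, p. 2: `f(β)` "depend[s] only on the hopping
matrix").

Technical note: this file imports only the gauge layer `HeisenbergOrderMerminWagnerGaugeProofs` of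
the tree's general-interaction chain and redoes the (short) model-dependent steps for the XXZ bond;
the four-term reduction of `ŜˣŜˣ`, `ŜʸŜʸ` to raising/lowering correlations and the bound
`‖𝟙 ⊗ a ⊗ 𝟙‖ ≤ ‖a‖` are re-derived as private helpers.

## Sources

* [KomaTasakiPRL1992] T. Koma, H. Tasaki, *Decay of superconducting and magnetic correlations in
  one- and two-dimensional Hubbard models*, PRL **68** (1992) 3248 = arXiv:cond-mat/9709068 (held;
  read: p. 2 Theorem and bound (4), p. 4 eqs. (5)–(12), p. 5 note [11] quoted above).
* [Ito1982] K. R. Ito, J. Stat. Phys. **29** (1982) 747 (Koma–Tasaki's reference [11] for the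
  extension of the McBryan–Spencer method to quantum spin systems).
* [McBryanSpencer1977] O. A. McBryan, T. Spencer, Comm. Math. Phys. **53** (1977) 299.
* [AizenmanEtAl2004] M. Aizenman, E. H. Lieb, R. Seiringer, J. P. Solovej, J. Yngvason, Phys. Rev.
  A **70** (2004) 023612 = arXiv:cond-mat/0403240, §2 (the model in spin language) and Theorem 1
  (Existence of BEC; the `d ≥ 3` theorem whose `d ≤ 2`, `T > 0` complement is §5 here); the model
  is (11.2) of [LSSY2005] E. H. Lieb, R. Seiringer, J. P. Solovej, J. Yngvason, *The Mathematics of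
  the Bose Gas and its Condensation* (2005), Ch. 11.
* [FriedliVelenik2017] S. Friedli, Y. Velenik, *Statistical Mechanics of Lattice Systems* (2017),
  §3.7.2 (long-range order versus decay of correlations).
-/

noncomputable section

open Matrix Complex Finset Filter Topology NormedSpace
open scoped Matrix.Norms.L2Operator ComplexOrder

namespace Literature.MathematicalPhysics.QuantumLattice.MerminWagner

open Literature.MathematicalPhysics.QuantumLattice Literature.Probability.LatticeModels
open Literature.Barriers.AtomisticToContinuum.BoseGas

/-! ### §0 Algebra of the perturbation map and gauge-fixed (axial) operators -/

section Algebra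

variable {m : Type*} [Fintype m]

/-- The Koma–Tasaki perturbation `P_W(B) = ½(W B W' + (W B W')ᴴ) - B` is additive in `B`.
[cite: KomaTasakiPRL1992, eqs. (7), (9)] -/
theorem hermitianPart_conj_sub_add (W W' A B : Matrix m m ℂ) :
    (2 : ℂ)⁻¹ • (W * (A + B) * W' + (W * (A + B) * W')ᴴ) - (A + B) =
      ((2 : ℂ)⁻¹ • (W * A * W' + (W * A * W')ᴴ) - A) +
        ((2 : ℂ)⁻¹ • (W * B * W' + (W * B * W')ᴴ) - B) := by
  simp only [Matrix.mul_add, Matrix.add_mul, conjTranspose_add, smul_add]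
  abel

/-- The perturbation map is additive over finite sums. [cite: KomaTasakiPRL1992, eqs. (7), (9)] -/
theorem hermitianPart_conj_sub_sum {ι : Type*} (s : Finset ι) (W W' : Matrix m m ℂ)
    (F : ι → Matrix m m ℂ) :
    (2 : ℂ)⁻¹ • (W * (∑ i ∈ s, F i) * W' + (W * (∑ i ∈ s, F i) * W')ᴴ) - ∑ i ∈ s, F i =
      ∑ i ∈ s, ((2 : ℂ)⁻¹ • (W * F i * W' + (W * F i * W')ᴴ) - F i) := by
  simp only [Finset.mul_sum, Finset.sum_mul, conjTranspose_sum, ← Finset.sum_add_distrib,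
    Finset.smul_sum, ← Finset.sum_sub_distrib]

/-- The perturbation map is homogeneous under REAL scalars (the adjoint fixes real scalars).
[cite: KomaTasakiPRL1992, eqs. (7), (9)] -/
theorem hermitianPart_conj_sub_smul_real (W W' A : Matrix m m ℂ) (r : ℝ) :
    (2 : ℂ)⁻¹ • (W * ((r : ℂ) • A) * W' + (W * ((r : ℂ) • A) * W')ᴴ) - (r : ℂ) • A =
      (r : ℂ) • ((2 : ℂ)⁻¹ • (W * A * W' + (W * A * W')ᴴ) - A) := by
  have hsr : star (r : ℂ) = r := Complex.conj_ofReal r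
  rw [Matrix.mul_smul, Matrix.smul_mul, conjTranspose_smul, hsr, ← smul_add, smul_comm, ← smul_sub]

/-- The perturbation VANISHES on a Hermitian operator fixed by the conjugation: if `W A W' = A` and
`Aᴴ = A` then `½(W A W' + (W A W')ᴴ) - A = 0` (the axial part of the Hamiltonian is invisible to the
imaginary gauge). [cite: KomaTasakiPRL1992, eq. (9)] -/
theorem hermitianPart_conj_sub_eq_zero (W W' : Matrix m m ℂ) {A : Matrix m m ℂ}
    (hA : A.IsHermitian) (hWA : W * A * W' = A) :
    (2 : ℂ)⁻¹ • (W * A * W' + (W * A * W')ᴴ) - A = 0 := by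
  rw [hWA, hA.eq, ← two_smul ℂ A, smul_smul, inv_mul_cancel₀ two_ne_zero, one_smul, sub_self]

/-- Hence adding a Hermitian gauge-fixed operator does not change the perturbation:
`P_W(B + D) = P_W(B)`. [cite: KomaTasakiPRL1992, eq. (9)] -/
theorem hermitianPart_conj_sub_add_of_fixed (W W' B : Matrix m m ℂ) {D : Matrix m m ℂ}
    (hD : D.IsHermitian) (hWD : W * D * W' = D) :
    (2 : ℂ)⁻¹ • (W * (B + D) * W' + (W * (B + D) * W')ᴴ) - (B + D) =
      (2 : ℂ)⁻¹ • (W * B * W' + (W * B * W')ᴴ) - B := by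
  rw [hermitianPart_conj_sub_add, hermitianPart_conj_sub_eq_zero W W' hD hWD, add_zero]

end Algebra

variable {Λ : Type*} [Fintype Λ] [DecidableEq Λ] {n : ℕ}

/-- The gauge fixes the axial spin: `W_ψ S³_x W_ψ⁻¹ = S³_x` (`S³` is diagonal in the basis in
which the gauge is diagonal). [cite: KomaTasakiPRL1992, eq. (8)] -/
theorem gauge_conj_siteSpin_two_eq (ψ : Λ → ℝ) (x : Λ) :
    ((Matrix.diagonal fun σ : TensorIndex _ (n + 1) =>
      ((Real.exp (-(∑ u, (ψ) u * ((σ u : ℕ) : ℝ))) : ℝ) : ℂ)) : Op Λ (n + 1)) * siteSpin n x 2 *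
      (Matrix.diagonal fun σ : TensorIndex _ (n + 1) =>
      ((Real.exp (-(∑ u, (-ψ) u * ((σ u : ℕ) : ℝ))) : ℝ) : ℂ)) = siteSpin n x 2 := by
  have h := gauge_conj_onSite (n := n) ψ x (SpinOperators.spinZ n)
  rw [siteSpin, spinVec_two]
  refine h.trans ?_
  congr 1
  rw [SpinOperators.spinZ, diagonal_mul_diagonal, diagonal_mul_diagonal]
  congr 1
  funext k
  rw [mul_right_comm, ← Complex.ofReal_mul, ← Real.exp_add, neg_add_cancel, Real.exp_zero,
    Complex.ofReal_one, one_mul]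

/-- The gauge fixes every axial field with a constant, `W_ψ (Σ_x (a_x 𝟙 + b_x Ŝᶻ_x)) W_ψ⁻¹ =
Σ_x (a_x 𝟙 + b_x Ŝᶻ_x)` — in particular a uniform field `-h Ŝᶻ_tot` and the staggered potential
`λ Σ_x [½ + (-1)^x S³_x]` of the hard-core lattice gas.
[cite: KomaTasakiPRL1992, eq. (8)] [cite: LSSY2005, Ch. 11 (11.2)] -/
theorem gauge_conj_axialField (ψ : Λ → ℝ) (a b : Λ → ℂ) :
    ((Matrix.diagonal fun σ : TensorIndex _ (n + 1) =>
      ((Real.exp (-(∑ u, (ψ) u * ((σ u : ℕ) : ℝ))) : ℝ) : ℂ)) : Op Λ (n + 1)) *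
      (∑ x : Λ, (a x • (1 : Op Λ (n + 1)) + b x • siteSpin n x 2)) *
      (Matrix.diagonal fun σ : TensorIndex _ (n + 1) =>
      ((Real.exp (-(∑ u, (-ψ) u * ((σ u : ℕ) : ℝ))) : ℝ) : ℂ)) =
      ∑ x : Λ, (a x • (1 : Op Λ (n + 1)) + b x • siteSpin n x 2) := by
  have h1 := gauge_mul_gauge_neg (n := n) ψ
  have hZ := gauge_conj_siteSpin_two_eq (n := n) ψ
  rw [Finset.mul_sum, Finset.sum_mul]
  refine Finset.sum_congr rfl fun x _ => ?_
  rw [Matrix.mul_add, Matrix.add_mul, Matrix.mul_smul, Matrix.smul_mul, Matrix.mul_one, h1,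
    Matrix.mul_smul, Matrix.smul_mul, hZ x]

/-! ### §1 One XXZ bond under the gauge (Koma–Tasaki eqs. (7)–(9) in closed form) -/

section Bond

/-- The planar part of a bond in terms of raising and lowering operators:
`Bˣ_{xy} + Bʸ_{xy} = ¼ (Ŝ⁺ₓŜ⁻_y + Ŝ⁻ₓŜ⁺_y + Ŝ⁺_yŜ⁻ₓ + Ŝ⁻_yŜ⁺ₓ)`. [folklore] -/
private theorem planarBond_eq (x y : Λ) :
    (spinBond n 0 x y + spinBond n 1 x y : Op Λ (n + 1)) =
      (1 / 4 : ℂ) • (onSite x (spinRaise n) * onSite y (spinLower n) +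
        onSite x (spinLower n) * onSite y (spinRaise n) +
        onSite y (spinRaise n) * onSite x (spinLower n) +
        onSite y (spinLower n) * onSite x (spinRaise n)) := by
  have hc : (1 / (2 * I) : ℂ) * (1 / (2 * I)) = -(1 / 4 : ℂ) := by
    rw [div_mul_div_comm, one_mul, show (2 * I * (2 * I) : ℂ) = 4 * (I * I) by ring, I_mul_I]
    norm_num
  have hx0 : (siteSpin n x 0 : Op Λ (n + 1)) =
      (1 / 2 : ℂ) • (onSite x (spinRaise n) + onSite x (spinLower n)) := by
    rw [siteSpin, spinVec_zero, spinX, onSite_smul', onSite_add']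
  have hy0 : (siteSpin n y 0 : Op Λ (n + 1)) =
      (1 / 2 : ℂ) • (onSite y (spinRaise n) + onSite y (spinLower n)) := by
    rw [siteSpin, spinVec_zero, spinX, onSite_smul', onSite_add']
  have hx1 : (siteSpin n x 1 : Op Λ (n + 1)) =
      (1 / (2 * I) : ℂ) • (onSite x (spinRaise n) - onSite x (spinLower n)) := by
    rw [siteSpin, spinVec_one, spinY, onSite_smul', onSite_sub']
  have hy1 : (siteSpin n y 1 : Op Λ (n + 1)) =
      (1 / (2 * I) : ℂ) • (onSite y (spinRaise n) - onSite y (spinLower n)) := by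
    rw [siteSpin, spinVec_one, spinY, onSite_smul', onSite_sub']
  simp only [spinBond, hx0, hy0, hx1, hy1, smul_mul_smul_comm, hc]
  simp only [mul_add, add_mul, mul_sub, sub_mul, smul_add, smul_sub, neg_smul, smul_neg]
  module

/-- `‖𝟙 ⊗ a ⊗ 𝟙‖ ≤ ‖a‖`: `a ↦ onSite z a` is an injective unital `*`-homomorphism of matrix
C⋆-algebras, hence isometric. [folklore] -/
private theorem opNorm_onSite_le (z : Λ) (a : Matrix (Fin (n + 1)) (Fin (n + 1)) ℂ) :
    ‖(onSite z a : Op Λ (n + 1))‖ ≤ ‖a‖ := by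
  letI : CStarAlgebra (Op Λ (n + 1)) := {}
  letI : CStarAlgebra (Matrix (Fin (n + 1)) (Fin (n + 1)) ℂ) := {}
  have hinj : Function.Injective
      (fun c : Matrix (Fin (n + 1)) (Fin (n + 1)) ℂ => (onSite z c : Op Λ (n + 1))) := by
    intro c c' h
    ext k l
    have h1 := congrFun (congrFun h (Function.update (fun _ => 0) z k))
      (Function.update (fun _ => 0) z l)
    simp only [onSite_apply, Function.update_self] at h1
    rwa [if_pos (fun y hy => by rw [Function.update_of_ne hy, Function.update_of_ne hy]),
      if_pos (fun y hy => by rw [Function.update_of_ne hy, Function.update_of_ne hy])] at h1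
  let f : Matrix (Fin (n + 1)) (Fin (n + 1)) ℂ →⋆ₐ[ℂ] Op Λ (n + 1) :=
    { toFun := fun c => onSite z c
      map_one' := onSite_one' z
      map_mul' := fun c c' => (onSite_mul z c c').symm
      map_zero' := onSite_zero z
      map_add' := onSite_add' z
      commutes' := fun c => by
        simp only [Algebra.algebraMap_eq_smul_one, onSite_smul', onSite_one']
      map_star' := fun c => onSite_conjTranspose z c }
  exact (NonUnitalStarAlgHom.norm_map f hinj a).le

/-- Products of one raising/lowering operator at a site with one at another site have norm
`≤ ‖Ŝ⁺‖²` (`‖Ŝ⁻‖ = ‖(Ŝ⁺)ᴴ‖ = ‖Ŝ⁺‖`). [folklore] -/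
private theorem opNorm_onSite_mul_onSite_le (x y : Λ) {a b : Matrix (Fin (n + 1)) (Fin (n + 1)) ℂ}
    (ha : a = spinRaise n ∨ a = spinLower n) (hb : b = spinRaise n ∨ b = spinLower n) :
    ‖(onSite x a * onSite y b : Op Λ (n + 1))‖ ≤ ‖spinRaise n‖ * ‖spinRaise n‖ := by
  have hn : ∀ c : Matrix (Fin (n + 1)) (Fin (n + 1)) ℂ, c = spinRaise n ∨ c = spinLower n →
      ‖c‖ = ‖spinRaise n‖ := by
    rintro c (rfl | rfl)
    · rfl
    · rw [spinLower_eq_conjTranspose, l2_opNorm_conjTranspose]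
  exact (l2_opNorm_mul _ _).trans (mul_le_mul ((opNorm_onSite_le x a).trans (hn a ha).le)
    ((opNorm_onSite_le y b).trans (hn b hb).le) (norm_nonneg _) (norm_nonneg _))

/-- **Koma–Tasaki's perturbation of one XXZ bond, in closed form**: with `δ = ψ_x - ψ_y`,
`½(W T W⁻¹ + (W T W⁻¹)ᴴ) - T = (cosh δ - 1)(B⁰_{xy} + B¹_{xy})` for the bond
`T = B⁰_{xy} + B¹_{xy} + Δ B²_{xy}` (`Bᵅ_{xy} = ½(ŜᵅₓŜᵅ_y + Ŝᵅ_yŜᵅₓ)`): the planar part is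
`¼(Ŝ⁺ₓŜ⁻_y + Ŝ⁻ₓŜ⁺_y + Ŝ⁺_yŜ⁻ₓ + Ŝ⁻_yŜ⁺ₓ)`, four gauge eigen-operators with eigenvalues `e^{±δ}`
(eq. (8)) whose `e^{δ}` and `e^{-δ}` halves are exchanged by the adjoint, and the Ising part `Δ B²` is
gauge fixed and Hermitian, hence invisible — the anisotropy `Δ` drops out.
[cite: KomaTasakiPRL1992, eqs. (7)–(9) and footnote 11] -/
theorem hermitianPart_gauge_xxzBond_sub (ψ : Λ → ℝ) (Δ : ℝ) (x y : Λ) :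
    (2 : ℂ)⁻¹ • (((Matrix.diagonal fun σ : TensorIndex _ (n + 1) =>
      ((Real.exp (-(∑ u, (ψ) u * ((σ u : ℕ) : ℝ))) : ℝ) : ℂ)) : Op Λ (n + 1)) *
      (spinBond n 0 x y + spinBond n 1 x y + (Δ : ℂ) • spinBond n 2 x y) *
      (Matrix.diagonal fun σ : TensorIndex _ (n + 1) =>
      ((Real.exp (-(∑ u, (-ψ) u * ((σ u : ℕ) : ℝ))) : ℝ) : ℂ)) +
      (((Matrix.diagonal fun σ : TensorIndex _ (n + 1) =>
      ((Real.exp (-(∑ u, (ψ) u * ((σ u : ℕ) : ℝ))) : ℝ) : ℂ)) : Op Λ (n + 1)) *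
      (spinBond n 0 x y + spinBond n 1 x y + (Δ : ℂ) • spinBond n 2 x y) *
      (Matrix.diagonal fun σ : TensorIndex _ (n + 1) =>
      ((Real.exp (-(∑ u, (-ψ) u * ((σ u : ℕ) : ℝ))) : ℝ) : ℂ)))ᴴ) -
      (spinBond n 0 x y + spinBond n 1 x y + (Δ : ℂ) • spinBond n 2 x y) =
      ((Real.cosh (ψ x - ψ y) - 1 : ℝ) : ℂ) • (spinBond n 0 x y + spinBond n 1 x y) := by
  set W : Op Λ (n + 1) := (Matrix.diagonal fun σ : TensorIndex _ (n + 1) =>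
      ((Real.exp (-(∑ u, (ψ) u * ((σ u : ℕ) : ℝ))) : ℝ) : ℂ)) with hW
  set W' : Op Λ (n + 1) := (Matrix.diagonal fun σ : TensorIndex _ (n + 1) =>
      ((Real.exp (-(∑ u, (-ψ) u * ((σ u : ℕ) : ℝ))) : ℝ) : ℂ)) with hW'
  -- the four raising/lowering products and their gauge eigenvalues
  set Px : Op Λ (n + 1) := onSite x (spinRaise n) with hPx
  set Mx : Op Λ (n + 1) := onSite x (spinLower n) with hMx
  set Py : Op Λ (n + 1) := onSite y (spinRaise n) with hPy
  set My : Op Λ (n + 1) := onSite y (spinLower n) with hMy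
  have h1 : W * (Px * My) * W' = ((Real.exp (ψ x - ψ y) : ℝ) : ℂ) • (Px * My) := by
    rw [hW, hW', hPx, hMy, gauge_conj_mul ψ (gauge_conj_spinRaise ψ x) (gauge_conj_spinLower ψ y),
      ← Complex.ofReal_mul, ← Real.exp_add, ← sub_eq_add_neg]
  have h2 : W * (Mx * Py) * W' = ((Real.exp (-(ψ x - ψ y)) : ℝ) : ℂ) • (Mx * Py) := by
    rw [hW, hW', hMx, hPy, gauge_conj_mul ψ (gauge_conj_spinLower ψ x) (gauge_conj_spinRaise ψ y),
      ← Complex.ofReal_mul, ← Real.exp_add, show -ψ x + ψ y = -(ψ x - ψ y) by ring]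
  have h3 : W * (Py * Mx) * W' = ((Real.exp (-(ψ x - ψ y)) : ℝ) : ℂ) • (Py * Mx) := by
    rw [hW, hW', hPy, hMx, gauge_conj_mul ψ (gauge_conj_spinRaise ψ y) (gauge_conj_spinLower ψ x),
      ← Complex.ofReal_mul, ← Real.exp_add, show ψ y + -ψ x = -(ψ x - ψ y) by ring]
  have h4 : W * (My * Px) * W' = ((Real.exp (ψ x - ψ y) : ℝ) : ℂ) • (My * Px) := by
    rw [hW, hW', hMy, hPx, gauge_conj_mul ψ (gauge_conj_spinLower ψ y) (gauge_conj_spinRaise ψ x),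
      ← Complex.ofReal_mul, ← Real.exp_add, show -ψ y + ψ x = ψ x - ψ y by ring]
  -- the Ising bond is gauge fixed
  have hS : ∀ z : Λ, W * siteSpin n z 2 * W' = siteSpin n z 2 := gauge_conj_siteSpin_two_eq ψ
  have hZ : W * spinBond n 2 x y * W' = spinBond n 2 x y := by
    have hxy := gauge_conj_mul ψ (A := siteSpin n x 2) (B := siteSpin n y 2) (κ := 1) (κ' := 1)
      (by rw [one_smul]; exact hS x) (by rw [one_smul]; exact hS y)
    have hyx := gauge_conj_mul ψ (A := siteSpin n y 2) (B := siteSpin n x 2) (κ := 1) (κ' := 1)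
      (by rw [one_smul]; exact hS y) (by rw [one_smul]; exact hS x)
    rw [one_mul, one_smul] at hxy hyx
    rw [spinBond, Matrix.mul_smul, Matrix.smul_mul, Matrix.mul_add, Matrix.add_mul, hxy, hyx]
  -- adjoints
  have hPc : ∀ z : Λ, (onSite z (spinRaise n) : Op Λ (n + 1))ᴴ = onSite z (spinLower n) :=
    fun z => by rw [← onSite_conjTranspose, ← spinLower_eq_conjTranspose]
  have hMc : ∀ z : Λ, (onSite z (spinLower n) : Op Λ (n + 1))ᴴ = onSite z (spinRaise n) :=
    fun z => by rw [← onSite_conjTranspose, spinLower_eq_conjTranspose, conjTranspose_conjTranspose]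
  have h1c : (Px * My)ᴴ = Py * Mx := by rw [conjTranspose_mul, hMc, hPc]
  have h2c : (Mx * Py)ᴴ = My * Px := by rw [conjTranspose_mul, hPc, hMc]
  have h3c : (Py * Mx)ᴴ = Px * My := by rw [conjTranspose_mul, hMc, hPc]
  have h4c : (My * Px)ᴴ = Mx * Py := by rw [conjTranspose_mul, hPc, hMc]
  have hZc : (spinBond n 2 x y : Op Λ (n + 1))ᴴ = spinBond n 2 x y := (spinBond_isHermitian n 2 x y).eq
  -- the planar part in terms of the four products
  have hplanar : (spinBond n 0 x y + spinBond n 1 x y : Op Λ (n + 1)) =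
      (1 / 4 : ℂ) • (Px * My + Mx * Py + Py * Mx + My * Px) := planarBond_eq x y
  have hT : (spinBond n 0 x y + spinBond n 1 x y + (Δ : ℂ) • spinBond n 2 x y : Op Λ (n + 1)) =
      (1 / 4 : ℂ) • (Px * My + Mx * Py + Py * Mx + My * Px) + (Δ : ℂ) • spinBond n 2 x y := by
    rw [hplanar]
  have hconj : W * (spinBond n 0 x y + spinBond n 1 x y + (Δ : ℂ) • spinBond n 2 x y) * W' =
      (1 / 4 : ℂ) • (((Real.exp (ψ x - ψ y) : ℝ) : ℂ) • (Px * My) +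
        ((Real.exp (-(ψ x - ψ y)) : ℝ) : ℂ) • (Mx * Py) +
        ((Real.exp (-(ψ x - ψ y)) : ℝ) : ℂ) • (Py * Mx) +
        ((Real.exp (ψ x - ψ y) : ℝ) : ℂ) • (My * Px)) + (Δ : ℂ) • spinBond n 2 x y := by
    rw [hT, Matrix.mul_add, Matrix.add_mul, Matrix.mul_smul, Matrix.smul_mul, Matrix.mul_smul,
      Matrix.smul_mul, hZ, Matrix.mul_add, Matrix.mul_add, Matrix.mul_add, Matrix.add_mul,
      Matrix.add_mul, Matrix.add_mul, h1, h2, h3, h4]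
  have hstar : ∀ r : ℝ, star ((r : ℝ) : ℂ) = (r : ℂ) := fun r => Complex.conj_ofReal r
  have h4s : star (1 / 4 : ℂ) = 1 / 4 := by
    rw [show (1 / 4 : ℂ) = ((1 / 4 : ℝ) : ℂ) by push_cast; ring, hstar]
  have hconjT : (W * (spinBond n 0 x y + spinBond n 1 x y + (Δ : ℂ) • spinBond n 2 x y) * W')ᴴ =
      (1 / 4 : ℂ) • (((Real.exp (ψ x - ψ y) : ℝ) : ℂ) • (Py * Mx) +
        ((Real.exp (-(ψ x - ψ y)) : ℝ) : ℂ) • (My * Px) +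
        ((Real.exp (-(ψ x - ψ y)) : ℝ) : ℂ) • (Px * My) +
        ((Real.exp (ψ x - ψ y) : ℝ) : ℂ) • (Mx * Py)) + (Δ : ℂ) • spinBond n 2 x y := by
    rw [hconj, conjTranspose_add, conjTranspose_smul, conjTranspose_smul, conjTranspose_add,
      conjTranspose_add, conjTranspose_add, conjTranspose_smul, conjTranspose_smul,
      conjTranspose_smul, conjTranspose_smul, h1c, h2c, h3c, h4c, hZc, hstar, hstar, hstar, h4s]
  have hcosh : ((Real.cosh (ψ x - ψ y) - 1 : ℝ) : ℂ) =
      (2 : ℂ)⁻¹ * (((Real.exp (ψ x - ψ y) : ℝ) : ℂ) + ((Real.exp (-(ψ x - ψ y)) : ℝ) : ℂ)) - 1 := by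
    rw [Real.cosh_eq]
    push_cast
    ring
  rw [hconjT, hconj, hT, hcosh, hplanar]
  module

/-- **Norm of the one-bond perturbation**: `‖½(W T W⁻¹ + h.c.) - T‖ ≤ ‖Ŝ⁺‖² (cosh (ψ_x - ψ_y) - 1)`
for the XXZ bond `T = B⁰_{xy} + B¹_{xy} + Δ B²_{xy}`, uniformly in `Δ`.
[cite: KomaTasakiPRL1992, eq. (11) (one term)] -/
theorem norm_hermitianPart_gauge_xxzBond_sub_le (ψ : Λ → ℝ) (Δ : ℝ) (x y : Λ) :
    ‖(2 : ℂ)⁻¹ • (((Matrix.diagonal fun σ : TensorIndex _ (n + 1) =>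
      ((Real.exp (-(∑ u, (ψ) u * ((σ u : ℕ) : ℝ))) : ℝ) : ℂ)) : Op Λ (n + 1)) *
      (spinBond n 0 x y + spinBond n 1 x y + (Δ : ℂ) • spinBond n 2 x y) *
      (Matrix.diagonal fun σ : TensorIndex _ (n + 1) =>
      ((Real.exp (-(∑ u, (-ψ) u * ((σ u : ℕ) : ℝ))) : ℝ) : ℂ)) +
      (((Matrix.diagonal fun σ : TensorIndex _ (n + 1) =>
      ((Real.exp (-(∑ u, (ψ) u * ((σ u : ℕ) : ℝ))) : ℝ) : ℂ)) : Op Λ (n + 1)) *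
      (spinBond n 0 x y + spinBond n 1 x y + (Δ : ℂ) • spinBond n 2 x y) *
      (Matrix.diagonal fun σ : TensorIndex _ (n + 1) =>
      ((Real.exp (-(∑ u, (-ψ) u * ((σ u : ℕ) : ℝ))) : ℝ) : ℂ)))ᴴ) -
      (spinBond n 0 x y + spinBond n 1 x y + (Δ : ℂ) • spinBond n 2 x y)‖ ≤
      ‖spinRaise n‖ * ‖spinRaise n‖ * (Real.cosh (ψ x - ψ y) - 1) := by
  have hc : 0 ≤ Real.cosh (ψ x - ψ y) - 1 := by linarith [Real.one_le_cosh (ψ x - ψ y)]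
  have hB : ‖(spinBond n 0 x y + spinBond n 1 x y : Op Λ (n + 1))‖ ≤
      ‖spinRaise n‖ * ‖spinRaise n‖ := by
    rw [planarBond_eq, norm_smul]
    have hq : ‖(1 / 4 : ℂ)‖ = 1 / 4 := by norm_num
    rw [hq]
    have hsum := norm_add_le_of_le (norm_add_le_of_le (norm_add_le_of_le
      (opNorm_onSite_mul_onSite_le (n := n) x y (Or.inl rfl) (Or.inr rfl))
      (opNorm_onSite_mul_onSite_le (n := n) x y (Or.inr rfl) (Or.inl rfl)))
      (opNorm_onSite_mul_onSite_le (n := n) y x (Or.inl rfl) (Or.inr rfl)))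
      (opNorm_onSite_mul_onSite_le (n := n) y x (Or.inr rfl) (Or.inl rfl))
    linarith
  rw [hermitianPart_gauge_xxzBond_sub, norm_smul, Complex.norm_real, Real.norm_eq_abs,
    abs_of_nonneg hc, mul_comm]
  exact mul_le_mul_of_nonneg_right hB hc

end Bond

/-! ### §2 The XXZ Hamiltonian of a finite graph under the gauge (Koma–Tasaki eq. (11)) -/

section Graph

variable (G : SimpleGraph Λ) [DecidableRel G.Adj]

/-- **Koma–Tasaki's eq. (11) for the XXZ model on a finite graph**: for every real `ψ`,
`‖½(W H W⁻¹ + (W H W⁻¹)ᴴ) - H‖ ≤ |J| ‖Ŝ⁺‖² Σ_u Σ_v [u ∼ v] (cosh (ψ_u - ψ_v) - 1)` for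
`H = J Σ_{⟨x,y⟩} (S¹_xS¹_y + S²_xS²_y + Δ S³_xS³_y)`, uniformly in the anisotropy `Δ` (one bond at a
time, `norm_hermitianPart_gauge_xxzBond_sub_le`; each edge is one of its two ordered pairs).
[cite: KomaTasakiPRL1992, eq. (11) and footnote 11] -/
theorem norm_hermitianPart_gauge_xxz_sub_le (J Δ : ℝ) (ψ : Λ → ℝ) :
    ‖(2 : ℂ)⁻¹ • (((Matrix.diagonal fun σ : TensorIndex _ (n + 1) =>
      ((Real.exp (-(∑ u, (ψ) u * ((σ u : ℕ) : ℝ))) : ℝ) : ℂ)) : Op Λ (n + 1)) *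
      xxzHamiltonian n G J Δ *
      (Matrix.diagonal fun σ : TensorIndex _ (n + 1) =>
      ((Real.exp (-(∑ u, (-ψ) u * ((σ u : ℕ) : ℝ))) : ℝ) : ℂ)) +
      (((Matrix.diagonal fun σ : TensorIndex _ (n + 1) =>
      ((Real.exp (-(∑ u, (ψ) u * ((σ u : ℕ) : ℝ))) : ℝ) : ℂ)) : Op Λ (n + 1)) *
      xxzHamiltonian n G J Δ *
      (Matrix.diagonal fun σ : TensorIndex _ (n + 1) =>
      ((Real.exp (-(∑ u, (-ψ) u * ((σ u : ℕ) : ℝ))) : ℝ) : ℂ)))ᴴ) - xxzHamiltonian n G J Δ‖ ≤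
      |J| * (‖spinRaise n‖ * ‖spinRaise n‖) *
        ∑ u, ∑ v, (if G.Adj u v then Real.cosh (ψ u - ψ v) - 1 else 0) := by
  set W : Op Λ (n + 1) := (Matrix.diagonal fun σ : TensorIndex _ (n + 1) =>
      ((Real.exp (-(∑ u, (ψ) u * ((σ u : ℕ) : ℝ))) : ℝ) : ℂ)) with hW
  set W' : Op Λ (n + 1) := (Matrix.diagonal fun σ : TensorIndex _ (n + 1) =>
      ((Real.exp (-(∑ u, (-ψ) u * ((σ u : ℕ) : ℝ))) : ℝ) : ℂ)) with hW'
  have hs0 : 0 ≤ ‖spinRaise n‖ * ‖spinRaise n‖ := mul_self_nonneg _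
  -- the perturbation map
  set P : Op Λ (n + 1) → Op Λ (n + 1) := fun B => (2 : ℂ)⁻¹ • (W * B * W' + (W * B * W')ᴴ) - B
    with hP
  have hPsum : ∀ (s' : Finset (Sym2 Λ)) (h : Sym2 Λ → Op Λ (n + 1)),
      P (∑ e ∈ s', h e) = ∑ e ∈ s', P (h e) := fun s' h =>
    hermitianPart_conj_sub_sum s' W W' h
  have hPsmul : ∀ (r : ℝ) (B : Op Λ (n + 1)), P ((r : ℂ) • B) = (r : ℂ) • P B := fun r B =>
    hermitianPart_conj_sub_smul_real W W' B r
  -- one bond at a time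
  have hwsymm : ∀ u v : Λ, Real.cosh (ψ u - ψ v) - 1 = Real.cosh (ψ v - ψ u) - 1 := fun u v => by
    rw [← Real.cosh_neg, neg_sub]
  have hw0 : ∀ u v : Λ, 0 ≤ Real.cosh (ψ u - ψ v) - 1 := fun u v => by
    linarith [Real.one_le_cosh (ψ u - ψ v)]
  have hbond : ∀ e : Sym2 Λ,
      ‖P (Sym2.lift ⟨fun x y => spinBond n 0 x y + spinBond n 1 x y + (Δ : ℂ) • spinBond n 2 x y,
        fun x y => by simp only [spinBond_comm]⟩ e)‖ ≤
        ‖spinRaise n‖ * ‖spinRaise n‖ *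
          Sym2.lift ⟨fun u v => Real.cosh (ψ u - ψ v) - 1, hwsymm⟩ e := by
    intro e
    induction e using Sym2.ind with
    | h x y =>
      rw [Sym2.lift_mk, Sym2.lift_mk]
      exact norm_hermitianPart_gauge_xxzBond_sub_le ψ Δ x y
  have hmain : ‖P (xxzHamiltonian n G J Δ)‖ ≤
      |J| * (‖spinRaise n‖ * ‖spinRaise n‖) *
        ∑ u, ∑ v, (if G.Adj u v then Real.cosh (ψ u - ψ v) - 1 else 0) := by
    rw [xxzHamiltonian, hPsmul, hPsum, norm_smul, Complex.norm_real, Real.norm_eq_abs, mul_assoc]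
    refine mul_le_mul_of_nonneg_left ?_ (abs_nonneg J)
    calc ‖∑ e ∈ G.edgeFinset, P (Sym2.lift ⟨fun x y => spinBond n 0 x y + spinBond n 1 x y +
            (Δ : ℂ) • spinBond n 2 x y, fun x y => by simp only [spinBond_comm]⟩ e)‖
        ≤ ∑ e ∈ G.edgeFinset, ‖P (Sym2.lift ⟨fun x y => spinBond n 0 x y + spinBond n 1 x y +
            (Δ : ℂ) • spinBond n 2 x y, fun x y => by simp only [spinBond_comm]⟩ e)‖ :=
          norm_sum_le _ _
      _ ≤ ∑ e ∈ G.edgeFinset, ‖spinRaise n‖ * ‖spinRaise n‖ *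
            Sym2.lift ⟨fun u v => Real.cosh (ψ u - ψ v) - 1, hwsymm⟩ e :=
          sum_le_sum fun e _ => hbond e
      _ = ‖spinRaise n‖ * ‖spinRaise n‖ *
            ∑ e ∈ G.edgeFinset, Sym2.lift ⟨fun u v => Real.cosh (ψ u - ψ v) - 1, hwsymm⟩ e :=
          (Finset.mul_sum _ _ _).symm
      _ ≤ ‖spinRaise n‖ * ‖spinRaise n‖ *
            ∑ u, ∑ v, (if G.Adj u v then Real.cosh (ψ u - ψ v) - 1 else 0) :=
          mul_le_mul_of_nonneg_left
            (sum_edgeFinset_lift_le_sum_sum_ite G (fun u v => Real.cosh (ψ u - ψ v) - 1) hwsymm hw0)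
            hs0
  exact hmain

/-- **Eq. (11) for the XXZ model plus any Hermitian axial term**: if `D = Dᴴ` is fixed by the
gauge `W_ψ` then `‖½(W (H + D) W⁻¹ + h.c.) - (H + D)‖ ≤ |J| ‖Ŝ⁺‖² Σ_u Σ_v [u ∼ v] (cosh (ψ_u - ψ_v) - 1)`
for `H = xxzHamiltonian n G J Δ` — terms along the symmetry axis are invisible to the method.
[cite: KomaTasakiPRL1992, eq. (11), the class (1) with `h_x = (0,0,h_x)`, and footnote 11] -/
theorem norm_hermitianPart_gauge_xxz_add_sub_le (J Δ : ℝ) (ψ : Λ → ℝ) {D : Op Λ (n + 1)}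
    (hD : D.IsHermitian)
    (hDg : ((Matrix.diagonal fun σ : TensorIndex _ (n + 1) =>
      ((Real.exp (-(∑ u, (ψ) u * ((σ u : ℕ) : ℝ))) : ℝ) : ℂ)) : Op Λ (n + 1)) * D *
      (Matrix.diagonal fun σ : TensorIndex _ (n + 1) =>
      ((Real.exp (-(∑ u, (-ψ) u * ((σ u : ℕ) : ℝ))) : ℝ) : ℂ)) = D) :
    ‖(2 : ℂ)⁻¹ • (((Matrix.diagonal fun σ : TensorIndex _ (n + 1) =>
      ((Real.exp (-(∑ u, (ψ) u * ((σ u : ℕ) : ℝ))) : ℝ) : ℂ)) : Op Λ (n + 1)) *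
      (xxzHamiltonian n G J Δ + D) *
      (Matrix.diagonal fun σ : TensorIndex _ (n + 1) =>
      ((Real.exp (-(∑ u, (-ψ) u * ((σ u : ℕ) : ℝ))) : ℝ) : ℂ)) +
      (((Matrix.diagonal fun σ : TensorIndex _ (n + 1) =>
      ((Real.exp (-(∑ u, (ψ) u * ((σ u : ℕ) : ℝ))) : ℝ) : ℂ)) : Op Λ (n + 1)) *
      (xxzHamiltonian n G J Δ + D) *
      (Matrix.diagonal fun σ : TensorIndex _ (n + 1) =>
      ((Real.exp (-(∑ u, (-ψ) u * ((σ u : ℕ) : ℝ))) : ℝ) : ℂ)))ᴴ) - (xxzHamiltonian n G J Δ + D)‖ ≤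
      |J| * (‖spinRaise n‖ * ‖spinRaise n‖) *
        ∑ u, ∑ v, (if G.Adj u v then Real.cosh (ψ u - ψ v) - 1 else 0) := by
  rw [hermitianPart_conj_sub_add_of_fixed _ _ _ hD hDg]
  exact norm_hermitianPart_gauge_xxz_sub_le G J Δ ψ

end Graph

/-! ### §3 The torus Gibbs state of a gauge eigen-operator (Koma–Tasaki eqs. (6), (10)–(12)) -/

section Torus

variable {d L : ℕ} [NeZero L]

/-- **Koma–Tasaki bound for the torus Gibbs state of the XXZ model with an axial term and a gauge
eigen-operator** (eqs. (6), (10)–(12)): for `H = xxzHamiltonian n (torusGraph d L) J Δ + D` with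
`D` Hermitian and fixed by `W_ψ`, `β ≥ 0`, and `W_ψ A W_ψ⁻¹ = a A`,
`|⟨A⟩_{β,L}| ≤ |a| ‖A‖ exp [β |J| ‖Ŝ⁺‖² Σ_u Σ_v [u ∼ v] (cosh (ψ_u - ψ_v) - 1)]`, from the
model-independent trace inequality `koma_tasaki_trace_bound` of the tree and §2.
[cite: KomaTasakiPRL1992, eqs. (6), (10)–(12) and footnote 11] -/
theorem norm_gibbsState_xxzTorus_le (n : ℕ) (J Δ : ℝ) {β : ℝ} (hβ : 0 ≤ β)
    (ψ : TorusSite d L → ℝ) {D : Op (TorusSite d L) (n + 1)} (hD : D.IsHermitian)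
    (hDg : ((Matrix.diagonal fun σ : TensorIndex _ (n + 1) =>
      ((Real.exp (-(∑ u, (ψ) u * ((σ u : ℕ) : ℝ))) : ℝ) : ℂ)) : Op (TorusSite d L) (n + 1)) * D *
      (Matrix.diagonal fun σ : TensorIndex _ (n + 1) =>
      ((Real.exp (-(∑ u, (-ψ) u * ((σ u : ℕ) : ℝ))) : ℝ) : ℂ)) = D)
    (A : Op (TorusSite d L) (n + 1)) (a : ℂ)
    (hA : ((Matrix.diagonal fun σ : TensorIndex _ (n + 1) =>
      ((Real.exp (-(∑ u, (ψ) u * ((σ u : ℕ) : ℝ))) : ℝ) : ℂ)) : Op (TorusSite d L) (n + 1)) * A *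
      (Matrix.diagonal fun σ : TensorIndex _ (n + 1) =>
      ((Real.exp (-(∑ u, (-ψ) u * ((σ u : ℕ) : ℝ))) : ℝ) : ℂ)) = a • A) :
    ‖gibbsState β (xxzHamiltonian n (torusGraph d L) J Δ + D) A‖ ≤
      ‖a‖ * ‖A‖ * Real.exp (β * (|J| * (‖spinRaise n‖ * ‖spinRaise n‖) *
        ∑ u, ∑ v, (if (torusGraph d L).Adj u v then Real.cosh (ψ u - ψ v) - 1 else 0))) := by
  set E : ℝ := |J| * (‖spinRaise n‖ * ‖spinRaise n‖) *
    ∑ u : TorusSite d L, ∑ v, (if (torusGraph d L).Adj u v then Real.cosh (ψ u - ψ v) - 1 else 0)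
    with hE
  set W : Op (TorusSite d L) (n + 1) := (Matrix.diagonal fun σ : TensorIndex _ (n + 1) =>
      ((Real.exp (-(∑ u, (ψ) u * ((σ u : ℕ) : ℝ))) : ℝ) : ℂ)) with hW
  set W' : Op (TorusSite d L) (n + 1) := (Matrix.diagonal fun σ : TensorIndex _ (n + 1) =>
      ((Real.exp (-(∑ u, (-ψ) u * ((σ u : ℕ) : ℝ))) : ℝ) : ℂ)) with hW'
  have h1 : W * W' = 1 := gauge_mul_gauge_neg ψ
  have h2 : W' * W = 1 := gauge_neg_mul_gauge ψ
  let Gu : (Op (TorusSite d L) (n + 1))ˣ := ⟨W, W', h1, h2⟩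
  set H : Op (TorusSite d L) (n + 1) := xxzHamiltonian n (torusGraph d L) J Δ + D with hH
  have hHh : H.IsHermitian := (xxzHamiltonian_isHermitian n _ J Δ).add hD
  have hβH : ((β : ℂ) • H).IsHermitian := isHermitian_real_smul hHh β
  have key := koma_tasaki_trace_bound hβH Gu A a hA
  have hneg : -((β : ℂ) • H) = -(β : ℂ) • H := (neg_smul _ _).symm
  rw [hneg] at key
  have hdev : ‖(2 : ℂ)⁻¹ • (W * H * W' + (W * H * W')ᴴ) - H‖ ≤ E :=
    norm_hermitianPart_gauge_xxz_add_sub_le (n := n) (torusGraph d L) J Δ ψ hD hDg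
  have hUn : ‖(2 : ℂ)⁻¹ • (W * ((β : ℂ) • H) * W' + (W * ((β : ℂ) • H) * W')ᴴ) - (β : ℂ) • H‖ ≤
      β * E := by
    have hsb : star (β : ℂ) = β := Complex.conj_ofReal β
    have hcalc : (2 : ℂ)⁻¹ • (W * ((β : ℂ) • H) * W' + (W * ((β : ℂ) • H) * W')ᴴ) - (β : ℂ) • H =
        (β : ℂ) • ((2 : ℂ)⁻¹ • (W * H * W' + (W * H * W')ᴴ) - H) := by
      rw [Matrix.mul_smul, Matrix.smul_mul, conjTranspose_smul, hsb, ← smul_add, smul_comm,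
        ← smul_sub]
    rw [hcalc, norm_smul, Complex.norm_real, Real.norm_eq_abs, abs_of_nonneg hβ]
    exact mul_le_mul_of_nonneg_left hdev hβ
  have htr : 0 ≤ ((NormedSpace.exp (-(β : ℂ) • H)).trace).re := by
    rw [← hneg, Complex.re_eq_norm.mpr (posSemidef_exp_of_isHermitian hβH.neg).trace_nonneg]
    exact norm_nonneg _
  refine norm_gibbsState_le_of_trace_bound hHh β A (key.trans ?_)
  exact mul_le_mul_of_nonneg_right
    (mul_le_mul_of_nonneg_left (Real.exp_le_exp.mpr hUn) (by positivity)) htr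

end Torus

/-! ### §4 Bound (4) of the source for the axial class: decay of the planar correlation -/

section Assembly

/-- If `a ≤ c e^{-t}` for every `t ≥ 0` (with `c ≥ 0`), then `a ≤ 0`. [folklore] -/
private theorem le_zero_of_forall_le_mul_exp_neg {a c : ℝ} (hc : 0 ≤ c)
    (h : ∀ t : ℝ, 0 ≤ t → a ≤ c * Real.exp (-t)) : a ≤ 0 := by
  by_contra ha
  push Not at ha
  have h2 : c / a < Real.exp (c / a) := by
    have := Real.add_one_le_exp (c / a)
    linarith
  have hca : 0 ≤ c / a := div_nonneg hc ha.le
  have h3 : c * Real.exp (-(c / a)) < a := by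
    rw [Real.exp_neg, ← div_eq_mul_inv, div_lt_iff₀ (Real.exp_pos _)]
    calc c = a * (c / a) := by field_simp
      _ < a * Real.exp (c / a) := mul_lt_mul_of_pos_left h2 ha
  linarith [h (c / a) hca]

/-- The planar correlation is controlled by the four raising/lowering correlations: for every
`ℂ`-linear functional `ω` with `‖ω(Ŝ^ε_x Ŝ^{ε'}_y)‖ ≤ B` (`ε, ε' = ±`),
`|Re ω(ŜˣₓŜˣ_y) + Re ω(ŜʸₓŜʸ_y)| ≤ 2B` (`Ŝˣ = ½(Ŝ⁺ + Ŝ⁻)`, `Ŝʸ = (Ŝ⁺ - Ŝ⁻)/(2i)`). [folklore] -/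
private theorem abs_re_planar_le_of_four (ω : Op Λ (n + 1) →ₗ[ℂ] ℂ) (x y : Λ) {B : ℝ}
    (hPP : ‖ω (onSite x (spinRaise n) * onSite y (spinRaise n))‖ ≤ B)
    (hPM : ‖ω (onSite x (spinRaise n) * onSite y (spinLower n))‖ ≤ B)
    (hMP : ‖ω (onSite x (spinLower n) * onSite y (spinRaise n))‖ ≤ B)
    (hMM : ‖ω (onSite x (spinLower n) * onSite y (spinLower n))‖ ≤ B) :
    |(ω (siteSpin n x 0 * siteSpin n y 0)).re + (ω (siteSpin n x 1 * siteSpin n y 1)).re| ≤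
      2 * B := by
  have hx0 : (siteSpin n x 0 : Op Λ (n + 1)) =
      (1 / 2 : ℂ) • (onSite x (spinRaise n) + onSite x (spinLower n)) := by
    rw [siteSpin, spinVec_zero, spinX, onSite_smul', onSite_add']
  have hy0 : (siteSpin n y 0 : Op Λ (n + 1)) =
      (1 / 2 : ℂ) • (onSite y (spinRaise n) + onSite y (spinLower n)) := by
    rw [siteSpin, spinVec_zero, spinX, onSite_smul', onSite_add']
  have hx1 : (siteSpin n x 1 : Op Λ (n + 1)) =
      (1 / (2 * I) : ℂ) • (onSite x (spinRaise n) - onSite x (spinLower n)) := by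
    rw [siteSpin, spinVec_one, spinY, onSite_smul', onSite_sub']
  have hy1 : (siteSpin n y 1 : Op Λ (n + 1)) =
      (1 / (2 * I) : ℂ) • (onSite y (spinRaise n) - onSite y (spinLower n)) := by
    rw [siteSpin, spinVec_one, spinY, onSite_smul', onSite_sub']
  have h0 : ‖ω (siteSpin n x 0 * siteSpin n y 0)‖ ≤ (1 / 4) * (B + B + (B + B)) := by
    rw [hx0, hy0, smul_mul_smul_comm, map_smul, norm_smul, add_mul, mul_add, mul_add, map_add,
      map_add, map_add]
    have hc : ‖(1 / 2 * (1 / 2) : ℂ)‖ = 1 / 4 := by norm_num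
    rw [hc]
    refine mul_le_mul_of_nonneg_left ?_ (by norm_num)
    exact norm_add_le_of_le (norm_add_le_of_le hPP hPM) (norm_add_le_of_le hMP hMM)
  have h1 : ‖ω (siteSpin n x 1 * siteSpin n y 1)‖ ≤ (1 / 4) * (B + B + (B + B)) := by
    rw [hx1, hy1, smul_mul_smul_comm, map_smul, norm_smul, sub_mul, mul_sub, mul_sub, map_sub,
      map_sub, map_sub]
    have hc : ‖(1 / (2 * I) * (1 / (2 * I)) : ℂ)‖ = 1 / 4 := by
      rw [norm_mul, norm_div, norm_mul, norm_one, Complex.norm_two, Complex.norm_I]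
      norm_num
    rw [hc]
    refine mul_le_mul_of_nonneg_left ?_ (by norm_num)
    exact norm_sub_le_of_le (norm_sub_le_of_le hPP hPM) (norm_sub_le_of_le hMP hMM)
  calc |(ω (siteSpin n x 0 * siteSpin n y 0)).re + (ω (siteSpin n x 1 * siteSpin n y 1)).re|
      ≤ |(ω (siteSpin n x 0 * siteSpin n y 0)).re| + |(ω (siteSpin n x 1 * siteSpin n y 1)).re| :=
        abs_add_le _ _
    _ ≤ ‖ω (siteSpin n x 0 * siteSpin n y 0)‖ + ‖ω (siteSpin n x 1 * siteSpin n y 1)‖ :=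
        add_le_add (Complex.abs_re_le_norm _) (Complex.abs_re_le_norm _)
    _ ≤ 2 * B := by linarith

/-- **From the gauge bound to a bound on the planar correlation** (the model-independent assembly
of eqs. (12)–(13)): if on a finite graph a `ℂ`-linear functional `ω` satisfies, for every real `φ`
and every gauge eigen-operator `A` (`W_φ A W_φ⁻¹ = a A`),
`‖ω A‖ ≤ ‖a‖ ‖A‖ exp (β K E(φ))` with `E(φ) = Σ_u Σ_v [u ∼ v](cosh (φ_u - φ_v) - 1)`, then for
every profile `ψ`, `|Re ω(ŜˣₓŜˣ_y) + Re ω(ŜʸₓŜʸ_y)| ≤ 2‖Ŝ⁺‖² exp (-(ψ_x - ψ_y) + β K E(ψ))`: the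
mixed raising/lowering correlations are eigen-operators with eigenvalue `e^{-(ψ_x - ψ_y)}` under
`W_ψ` resp. `W_{-ψ}` (same energy), the equal-sign ones are killed by constant profiles (energy `0`,
eigenvalue `e^{-t}` for every `t`). [cite: KomaTasakiPRL1992, eqs. (8), (12)–(13)] -/
private theorem abs_re_planar_le_of_gaugeBound {V : Type*} [Fintype V] [DecidableEq V]
    (G : SimpleGraph V) [DecidableRel G.Adj] (ω : Op V (n + 1) →ₗ[ℂ] ℂ) {β K : ℝ}
    (hgauge : ∀ (φ : V → ℝ) (A : Op V (n + 1)) (a : ℂ),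
      ((Matrix.diagonal fun σ : TensorIndex _ (n + 1) =>
      ((Real.exp (-(∑ u, (φ) u * ((σ u : ℕ) : ℝ))) : ℝ) : ℂ)) : Op V (n + 1)) * A *
      (Matrix.diagonal fun σ : TensorIndex _ (n + 1) =>
      ((Real.exp (-(∑ u, (-φ) u * ((σ u : ℕ) : ℝ))) : ℝ) : ℂ)) = a • A →
      ‖ω A‖ ≤ ‖a‖ * ‖A‖ * Real.exp (β * (K *
        ∑ u, ∑ v, (if G.Adj u v then Real.cosh (φ u - φ v) - 1 else 0))))
    (x y : V) (ψ : V → ℝ) :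
    |(ω (siteSpin n x 0 * siteSpin n y 0)).re + (ω (siteSpin n x 1 * siteSpin n y 1)).re| ≤
      2 * (‖spinRaise n‖ * ‖spinRaise n‖) * Real.exp (-(ψ x - ψ y) + β * (K *
        ∑ u, ∑ v, (if G.Adj u v then Real.cosh (ψ u - ψ v) - 1 else 0))) := by
  have hs0 : 0 ≤ ‖spinRaise n‖ * ‖spinRaise n‖ := mul_self_nonneg _
  have hB0 : 0 ≤ ‖spinRaise n‖ * ‖spinRaise n‖ * Real.exp (-(ψ x - ψ y) + β * (K *
      ∑ u, ∑ v, (if G.Adj u v then Real.cosh (ψ u - ψ v) - 1 else 0))) := by positivity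
  -- the energy of the negated profile
  have hEneg : (∑ u, ∑ v, (if G.Adj u v then Real.cosh ((-ψ) u - (-ψ) v) - 1 else 0)) =
      ∑ u, ∑ v, (if G.Adj u v then Real.cosh (ψ u - ψ v) - 1 else 0) := by
    refine sum_congr rfl fun u _ => sum_congr rfl fun v _ => ?_
    rw [Pi.neg_apply, Pi.neg_apply, show -ψ u - -ψ v = -(ψ u - ψ v) by ring, Real.cosh_neg]
  -- the mixed correlations: eigenvalue `e^{-(ψ x - ψ y)}`, energy `E(ψ)`
  have hmixed : ∀ (A : Op V (n + 1)) (φ : V → ℝ), ‖A‖ ≤ ‖spinRaise n‖ * ‖spinRaise n‖ →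
      (∑ u, ∑ v, (if G.Adj u v then Real.cosh (φ u - φ v) - 1 else 0)) =
        ∑ u, ∑ v, (if G.Adj u v then Real.cosh (ψ u - ψ v) - 1 else 0) →
      ((Matrix.diagonal fun σ : TensorIndex _ (n + 1) =>
      ((Real.exp (-(∑ u, (φ) u * ((σ u : ℕ) : ℝ))) : ℝ) : ℂ)) : Op V (n + 1)) * A *
      (Matrix.diagonal fun σ : TensorIndex _ (n + 1) =>
      ((Real.exp (-(∑ u, (-φ) u * ((σ u : ℕ) : ℝ))) : ℝ) : ℂ)) =
        ((Real.exp (-(ψ x - ψ y)) : ℝ) : ℂ) • A →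
      ‖ω A‖ ≤ ‖spinRaise n‖ * ‖spinRaise n‖ * Real.exp (-(ψ x - ψ y) + β * (K *
        ∑ u, ∑ v, (if G.Adj u v then Real.cosh (ψ u - ψ v) - 1 else 0))) := by
    intro A φ hA hEφ hev
    refine (hgauge φ A _ hev).trans ?_
    rw [Complex.norm_real, Real.norm_eq_abs, abs_of_pos (Real.exp_pos _), hEφ, Real.exp_add,
      mul_right_comm (Real.exp _) ‖A‖, mul_comm (‖spinRaise n‖ * ‖spinRaise n‖)]
    exact mul_le_mul_of_nonneg_left hA (by positivity)
  have hPM : ‖ω (onSite x (spinRaise n) * onSite y (spinLower n))‖ ≤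
      ‖spinRaise n‖ * ‖spinRaise n‖ * Real.exp (-(ψ x - ψ y) + β * (K *
        ∑ u, ∑ v, (if G.Adj u v then Real.cosh (ψ u - ψ v) - 1 else 0))) := by
    refine hmixed _ (-ψ) (opNorm_onSite_mul_onSite_le x y (Or.inl rfl) (Or.inr rfl)) hEneg ?_
    rw [gauge_conj_mul (-ψ) (gauge_conj_spinRaise (n := n) (-ψ) x)
      (gauge_conj_spinLower (n := n) (-ψ) y), ← Complex.ofReal_mul, ← Real.exp_add, Pi.neg_apply,
      Pi.neg_apply, neg_neg, show -ψ x + ψ y = -(ψ x - ψ y) by ring]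
  have hMP : ‖ω (onSite x (spinLower n) * onSite y (spinRaise n))‖ ≤
      ‖spinRaise n‖ * ‖spinRaise n‖ * Real.exp (-(ψ x - ψ y) + β * (K *
        ∑ u, ∑ v, (if G.Adj u v then Real.cosh (ψ u - ψ v) - 1 else 0))) := by
    refine hmixed _ ψ (opNorm_onSite_mul_onSite_le x y (Or.inr rfl) (Or.inl rfl)) rfl ?_
    rw [gauge_conj_mul ψ (gauge_conj_spinLower (n := n) ψ x) (gauge_conj_spinRaise (n := n) ψ y),
      ← Complex.ofReal_mul, ← Real.exp_add, show -ψ x + ψ y = -(ψ x - ψ y) by ring]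
  -- the equal-sign correlations vanish: constant profiles have zero energy
  have hequal : ∀ (A : Op V (n + 1)) (ε : ℝ), ‖A‖ ≤ ‖spinRaise n‖ * ‖spinRaise n‖ →
      (∀ t : ℝ, ((Matrix.diagonal fun σ : TensorIndex _ (n + 1) =>
        ((Real.exp (-(∑ u, (fun _ : V => ε * t) u * ((σ u : ℕ) : ℝ))) : ℝ) : ℂ)) : Op V (n + 1)) *
        A * (Matrix.diagonal fun σ : TensorIndex _ (n + 1) =>
        ((Real.exp (-(∑ u, (-fun _ : V => ε * t) u * ((σ u : ℕ) : ℝ))) : ℝ) : ℂ)) =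
          ((Real.exp (-t) : ℝ) : ℂ) • A) →
      ‖ω A‖ ≤ ‖spinRaise n‖ * ‖spinRaise n‖ * Real.exp (-(ψ x - ψ y) + β * (K *
        ∑ u, ∑ v, (if G.Adj u v then Real.cosh (ψ u - ψ v) - 1 else 0))) := by
    intro A ε hA hev
    refine le_trans ?_ hB0
    refine le_zero_of_forall_le_mul_exp_neg hs0 fun t _ => ?_
    have h := hgauge (fun _ : V => ε * t) A _ (hev t)
    simp only [sub_self, Real.cosh_zero, ite_self, Finset.sum_const_zero, mul_zero,
      Real.exp_zero, mul_one, Complex.norm_real, Real.norm_eq_abs, abs_of_pos (Real.exp_pos _)]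
      at h
    rw [mul_comm]
    exact h.trans (mul_le_mul_of_nonneg_left hA (Real.exp_pos _).le)
  have hPP : ‖ω (onSite x (spinRaise n) * onSite y (spinRaise n))‖ ≤
      ‖spinRaise n‖ * ‖spinRaise n‖ * Real.exp (-(ψ x - ψ y) + β * (K *
        ∑ u, ∑ v, (if G.Adj u v then Real.cosh (ψ u - ψ v) - 1 else 0))) := by
    refine hequal _ (-(1 / 2)) (opNorm_onSite_mul_onSite_le x y (Or.inl rfl) (Or.inl rfl))
      fun t => ?_
    rw [gauge_conj_mul (fun _ : V => -(1 / 2) * t) (gauge_conj_spinRaise (n := n) _ x)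
      (gauge_conj_spinRaise (n := n) _ y), ← Complex.ofReal_mul, ← Real.exp_add,
      show -(1 / 2) * t + -(1 / 2) * t = -t by ring]
  have hMM : ‖ω (onSite x (spinLower n) * onSite y (spinLower n))‖ ≤
      ‖spinRaise n‖ * ‖spinRaise n‖ * Real.exp (-(ψ x - ψ y) + β * (K *
        ∑ u, ∑ v, (if G.Adj u v then Real.cosh (ψ u - ψ v) - 1 else 0))) := by
    refine hequal _ (1 / 2) (opNorm_onSite_mul_onSite_le x y (Or.inr rfl) (Or.inr rfl))
      fun t => ?_
    rw [gauge_conj_mul (fun _ : V => 1 / 2 * t) (gauge_conj_spinLower (n := n) _ x)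
      (gauge_conj_spinLower (n := n) _ y), ← Complex.ofReal_mul, ← Real.exp_add,
      show -(1 / 2 * t) + -(1 / 2 * t) = -t by ring]
  rw [mul_assoc]
  exact abs_re_planar_le_of_four ω x y hPP hPM hMP hMM

variable {L : ℕ} [NeZero L]

/-- **Koma–Tasaki's bound (4) for the axially symmetric class, `d = 2` (note [11] of the source),
with explicit constants.** For the spin-`n/2` XXZ model `J Σ_{⟨x,y⟩}(S¹_xS¹_y + S²_xS²_y + Δ S³_xS³_y)`
on the discrete torus `(ℤ/Lℤ)²` plus ANY Hermitian term `D` fixed by the imaginary gauges `W_ψ`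
(axial fields, uniform or staggered; Ising couplings), at every inverse temperature `β ≥ 0`:
`|Re ⟨S¹_xS¹_y⟩_{β,L} + Re ⟨S²_xS²_y⟩_{β,L}| ≤ 2‖Ŝ⁺‖² e^{1/2} (dist(x,y) + 1)^{-q/2}`,
`q = 1/(128 β|J|‖Ŝ⁺‖² + 1)` — uniformly in the side `L`, the anisotropy `Δ` and the axial part `D`
(power-law decay with an exponent `∝ 1/β` at low temperature). Proof: §3 and the tree's
McBryan–Spencer profile `exists_testFunction_two` (`ψ_x - ψ_y = q log (dist + 1)`, energy
`≤ 64 q² (log (dist + 1) + 1)`), `128 β|J|‖Ŝ⁺‖² q² ≤ q`.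
[cite: KomaTasakiPRL1992, Theorem, bound (4) and footnote 11] -/
theorem abs_xxz_planarCorr_le_rpow_two (n : ℕ) (J Δ : ℝ) {β : ℝ} (hβ : 0 ≤ β)
    {D : Op (TorusSite 2 L) (n + 1)} (hD : D.IsHermitian)
    (hDg : ∀ ψ : TorusSite 2 L → ℝ, ((Matrix.diagonal fun σ : TensorIndex _ (n + 1) =>
      ((Real.exp (-(∑ u, (ψ) u * ((σ u : ℕ) : ℝ))) : ℝ) : ℂ)) : Op (TorusSite 2 L) (n + 1)) * D *
      (Matrix.diagonal fun σ : TensorIndex _ (n + 1) =>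
      ((Real.exp (-(∑ u, (-ψ) u * ((σ u : ℕ) : ℝ))) : ℝ) : ℂ)) = D)
    (x y : TorusSite 2 L) :
    |(gibbsState β (xxzHamiltonian n (torusGraph 2 L) J Δ + D) (siteSpin n x 0 * siteSpin n y 0)).re +
        (gibbsState β (xxzHamiltonian n (torusGraph 2 L) J Δ + D)
          (siteSpin n x 1 * siteSpin n y 1)).re| ≤
      2 * (‖spinRaise n‖ * ‖spinRaise n‖) * Real.exp (1 / 2) *
        ((torusDist x y : ℝ) + 1) ^
          (-(1 / (128 * (β * (|J| * (‖spinRaise n‖ * ‖spinRaise n‖))) + 1) / 2)) := by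
  have hK : 0 ≤ |J| * (‖spinRaise n‖ * ‖spinRaise n‖) := by positivity
  obtain ⟨hq0, hq1, hq⟩ :=
    charge_ineq (c := 128 * (β * (|J| * (‖spinRaise n‖ * ‖spinRaise n‖)))) (by positivity)
  set q : ℝ := 1 / (128 * (β * (|J| * (‖spinRaise n‖ * ‖spinRaise n‖))) + 1) with hqdef
  obtain ⟨ψ, hψ, hE⟩ := exists_testFunction_two x y hq0.le hq1
  have key := abs_re_planar_le_of_gaugeBound (n := n) (torusGraph 2 L)
    (gibbsState β (xxzHamiltonian n (torusGraph 2 L) J Δ + D))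
    (fun φ A a hA => norm_gibbsState_xxzTorus_le n J Δ hβ φ hD (hDg φ) A a hA) x y ψ
  set R : ℕ := torusDist x y with hR
  set E : ℝ := ∑ u, ∑ v, (if (torusGraph 2 L).Adj u v then Real.cosh (ψ u - ψ v) - 1 else 0)
    with hEdef
  have hℓ0 : 0 ≤ Real.log ((R : ℝ) + 1) := Real.log_nonneg (by simp)
  refine key.trans ?_
  rw [hψ, mul_assoc (2 * (‖spinRaise n‖ * ‖spinRaise n‖)) (Real.exp (1 / 2)),
    Real.rpow_def_of_pos (by positivity), ← Real.exp_add]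
  refine mul_le_mul_of_nonneg_left (Real.exp_le_exp.mpr ?_) (by positivity)
  have hE' : β * (|J| * (‖spinRaise n‖ * ‖spinRaise n‖) * E) ≤
      β * (|J| * (‖spinRaise n‖ * ‖spinRaise n‖) * (64 * q ^ 2 * (Real.log ((R : ℝ) + 1) + 1))) :=
    mul_le_mul_of_nonneg_left (mul_le_mul_of_nonneg_left hE hK) hβ
  have hbq : 128 * (β * (|J| * (‖spinRaise n‖ * ‖spinRaise n‖))) * q ^ 2 * Real.log ((R : ℝ) + 1) ≤
      q * Real.log ((R : ℝ) + 1) := mul_le_mul_of_nonneg_right hq hℓ0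
  nlinarith [hE', hbq, hq, hq1, hℓ0]

/-- **The one-dimensional case: exponential decay** (note [11]: "and the corresponding bound in one
dimension"). For the same class on the ring `ℤ/Lℤ`, at every `β ≥ 0`,
`|Re ⟨S¹_xS¹_y⟩_{β,L} + Re ⟨S²_xS²_y⟩_{β,L}| ≤ 2‖Ŝ⁺‖² exp (-m dist(x,y))` with
`m = q/2`, `q = 1/(16 β|J|‖Ŝ⁺‖² + 1)` — correlation length `ξ = 1/m ≤ 2(16 β|J|‖Ŝ⁺‖² + 1)`, linear
in `β` at low temperature, uniformly in `L`, `Δ`, `D`. Proof: §3 and the tree's linear profile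
`exists_testFunction_one` (`ψ_x - ψ_y = q dist`, energy `≤ 8 q² dist`), `16 β|J|‖Ŝ⁺‖² q² ≤ q`.
[cite: KomaTasakiPRL1992, Theorem (one-dimensional case), bound (4) and footnote 11] -/
theorem abs_xxz_planarCorr_le_exp_one {L : ℕ} [NeZero L] (n : ℕ) (J Δ : ℝ) {β : ℝ} (hβ : 0 ≤ β)
    {D : Op (TorusSite 1 L) (n + 1)} (hD : D.IsHermitian)
    (hDg : ∀ ψ : TorusSite 1 L → ℝ, ((Matrix.diagonal fun σ : TensorIndex _ (n + 1) =>
      ((Real.exp (-(∑ u, (ψ) u * ((σ u : ℕ) : ℝ))) : ℝ) : ℂ)) : Op (TorusSite 1 L) (n + 1)) * D *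
      (Matrix.diagonal fun σ : TensorIndex _ (n + 1) =>
      ((Real.exp (-(∑ u, (-ψ) u * ((σ u : ℕ) : ℝ))) : ℝ) : ℂ)) = D)
    (x y : TorusSite 1 L) :
    |(gibbsState β (xxzHamiltonian n (torusGraph 1 L) J Δ + D) (siteSpin n x 0 * siteSpin n y 0)).re +
        (gibbsState β (xxzHamiltonian n (torusGraph 1 L) J Δ + D)
          (siteSpin n x 1 * siteSpin n y 1)).re| ≤
      2 * (‖spinRaise n‖ * ‖spinRaise n‖) *
        Real.exp (-(1 / (16 * (β * (|J| * (‖spinRaise n‖ * ‖spinRaise n‖))) + 1) / 2 *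
          (torusDist x y : ℝ))) := by
  have hK : 0 ≤ |J| * (‖spinRaise n‖ * ‖spinRaise n‖) := by positivity
  obtain ⟨hq0, hq1, hq⟩ :=
    charge_ineq (c := 16 * (β * (|J| * (‖spinRaise n‖ * ‖spinRaise n‖)))) (by positivity)
  set q : ℝ := 1 / (16 * (β * (|J| * (‖spinRaise n‖ * ‖spinRaise n‖))) + 1) with hqdef
  obtain ⟨ψ, hψ, hE⟩ := exists_testFunction_one x y hq0.le hq1
  have key := abs_re_planar_le_of_gaugeBound (n := n) (torusGraph 1 L)
    (gibbsState β (xxzHamiltonian n (torusGraph 1 L) J Δ + D))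
    (fun φ A a hA => norm_gibbsState_xxzTorus_le n J Δ hβ φ hD (hDg φ) A a hA) x y ψ
  set R : ℕ := torusDist x y with hR
  set E : ℝ := ∑ u, ∑ v, (if (torusGraph 1 L).Adj u v then Real.cosh (ψ u - ψ v) - 1 else 0)
    with hEdef
  have hR0 : (0 : ℝ) ≤ R := by positivity
  refine key.trans ?_
  rw [hψ]
  refine mul_le_mul_of_nonneg_left (Real.exp_le_exp.mpr ?_) (by positivity)
  have hE' : β * (|J| * (‖spinRaise n‖ * ‖spinRaise n‖) * E) ≤
      β * (|J| * (‖spinRaise n‖ * ‖spinRaise n‖) * (8 * q ^ 2 * R)) :=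
    mul_le_mul_of_nonneg_left (mul_le_mul_of_nonneg_left hE hK) hβ
  have hbq : 16 * (β * (|J| * (‖spinRaise n‖ * ‖spinRaise n‖))) * q ^ 2 * R ≤ q * R :=
    mul_le_mul_of_nonneg_right hq hR0
  nlinarith [hE', hbq]

/-- An exponential bound with rate `m ∈ (0, 1]` is a power-law bound with exponent `1`:
`e^{-mR} ≤ m⁻¹ (R + 1)^{-1}` for `R ≥ 0` (`m(R + 1) ≤ mR + 1 ≤ e^{mR}`). [folklore] -/
private theorem exp_neg_mul_le_inv_mul_rpow {m R : ℝ} (hm : 0 < m) (hm1 : m ≤ 1) (hR : 0 ≤ R) :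
    Real.exp (-(m * R)) ≤ m⁻¹ * (R + 1) ^ (-(1 : ℝ)) := by
  rw [Real.rpow_neg_one, ← mul_inv, Real.exp_neg]
  refine inv_anti₀ (by positivity) ?_
  calc m * (R + 1) = m * R + m := by ring
    _ ≤ m * R + 1 := by linarith
    _ ≤ Real.exp (m * R) := Real.add_one_le_exp _

/-- **Uniform power-law decay of the planar correlation in `d ∈ {1, 2}`** (both cases of the
source packaged in the form used by the long-range-order lemmas): for the axial class at `β ≥ 0`
there are `f > 0` and `C` — depending only on `β|J|‖Ŝ⁺‖²` and `‖Ŝ⁺‖`, NOT on `L`, `Δ` or the axial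
term `D` — with `|Re ⟨S¹_xS¹_y⟩_{β,L} + Re ⟨S²_xS²_y⟩_{β,L}| ≤ C (dist(x,y) + 1)^{-f}` on every
torus `(ℤ/Lℤ)^d` and for every admissible `D` (in `d = 1` the exponential bound is weakened to
`f = 1`). [cite: KomaTasakiPRL1992, Theorem, bound (4) and footnote 11] -/
theorem exists_abs_xxz_planarCorr_le_rpow {d : ℕ} (hd : d = 1 ∨ d = 2) (n : ℕ) (J Δ : ℝ) {β : ℝ}
    (hβ : 0 ≤ β) :
    ∃ f : ℝ, 0 < f ∧ ∃ C : ℝ, ∀ (L : ℕ) [NeZero L] (D : Op (TorusSite d L) (n + 1)),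
      D.IsHermitian →
      (∀ ψ : TorusSite d L → ℝ, ((Matrix.diagonal fun σ : TensorIndex _ (n + 1) =>
        ((Real.exp (-(∑ u, (ψ) u * ((σ u : ℕ) : ℝ))) : ℝ) : ℂ)) : Op (TorusSite d L) (n + 1)) * D *
        (Matrix.diagonal fun σ : TensorIndex _ (n + 1) =>
        ((Real.exp (-(∑ u, (-ψ) u * ((σ u : ℕ) : ℝ))) : ℝ) : ℂ)) = D) →
      ∀ x y : TorusSite d L,
        |(gibbsState β (xxzHamiltonian n (torusGraph d L) J Δ + D)
            (siteSpin n x 0 * siteSpin n y 0)).re +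
          (gibbsState β (xxzHamiltonian n (torusGraph d L) J Δ + D)
            (siteSpin n x 1 * siteSpin n y 1)).re| ≤
          C * ((torusDist x y : ℝ) + 1) ^ (-f) := by
  rcases hd with rfl | rfl
  · obtain ⟨hq0, hq1, -⟩ :=
      charge_ineq (c := 16 * (β * (|J| * (‖spinRaise n‖ * ‖spinRaise n‖)))) (by positivity)
    refine ⟨1, one_pos, 2 * (‖spinRaise n‖ * ‖spinRaise n‖) *
      (1 / (16 * (β * (|J| * (‖spinRaise n‖ * ‖spinRaise n‖))) + 1) / 2)⁻¹,
      fun L _ D hD hDg x y => ?_⟩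
    refine (abs_xxz_planarCorr_le_exp_one n J Δ hβ hD hDg x y).trans ?_
    rw [mul_assoc (2 * (‖spinRaise n‖ * ‖spinRaise n‖)) _ (((torusDist x y : ℝ) + 1) ^ (-(1 : ℝ)))]
    exact mul_le_mul_of_nonneg_left
      (exp_neg_mul_le_inv_mul_rpow (by positivity) (by linarith) (by positivity)) (by positivity)
  · exact ⟨1 / (128 * (β * (|J| * (‖spinRaise n‖ * ‖spinRaise n‖))) + 1) / 2, by positivity,
      2 * (‖spinRaise n‖ * ‖spinRaise n‖) * Real.exp (1 / 2),
      fun L _ D hD hDg x y => abs_xxz_planarCorr_le_rpow_two n J Δ hβ hD hDg x y⟩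

end Assembly

/-! ### §5 No planar long-range order at `T > 0` in `d ≤ 2` -/

section NoLRO

variable {d : ℕ}

/-- **Uniform power-law decay excludes long-range order along the even tori** (the
reflection-positivity convention `HasEvenTorusLRO` of `XYOrder`): if `|G_L(x,y)| ≤ C (dist+1)^{-f}`
on every torus `(ℤ/Lℤ)^d` (`d ≥ 1`, `f > 0`, `C` uniform in `L`) then the box averages along the
sides `2k` tend to `0` (the tree's `tendsto_normalizedSum_zero_of_abs_le_rpow` /
`not_hasLongRangeOrder_subseq_of_abs_le_rpow` with `s k = 2k`), so their `liminf` is not positive.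
[cite: FriedliVelenik2017, §3.7.2 Definition 3.27] -/
theorem not_hasEvenTorusLRO_of_abs_le_rpow (hd : d ≠ 0)
    {G : (L : ℕ) → TorusSite d L → TorusSite d L → ℝ} {C f : ℝ} (hf : 0 < f)
    (hG : ∀ (L : ℕ) [NeZero L] (x y : TorusSite d L),
      |G L x y| ≤ C * ((torusDist x y : ℝ) + 1) ^ (-f)) :
    ¬ HasEvenTorusLRO G :=
  Literature.Barriers.HubbardSuperconductivity.not_hasLongRangeOrder_subseq_of_abs_le_rpow hd hf hG
    (s := fun k => 2 * k) (tendsto_atTop_atTop.2 fun b => ⟨b, fun k hk => by omega⟩)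

/-! #### The quantum XY model (`J = -1`, `Δ = 0`, `D = 0`) -/

/-- **No planar long-range order in the quantum XY model at `T > 0`, `d ≤ 2` — the uniform decay
bound.** For `d ∈ {1,2}`, every spin `n/2` and every `β ≥ 0` there are `f > 0`, `C` with
`|xyCorrTorus β L n x y| = |Re ⟨S¹_xS¹_y + S²_xS²_y⟩_{β,L}| ≤ C (dist(x,y) + 1)^{-f}` on all tori
`(ℤ/Lℤ)^d`, uniformly in `L` (the XY model is the axial class with `J = -1`, `Δ = 0`, `D = 0`).
[cite: KomaTasakiPRL1992, bound (4) and footnote 11] -/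
theorem xy_thermal_exists_abs_corr_le_rpow (hd : d = 1 ∨ d = 2) (n : ℕ) {β : ℝ} (hβ : 0 ≤ β) :
    ∃ f : ℝ, 0 < f ∧ ∃ C : ℝ, ∀ (L : ℕ) [NeZero L] (x y : TorusSite d L),
      |xyCorrTorus (d := d) β L n x y| ≤ C * ((torusDist x y : ℝ) + 1) ^ (-f) := by
  obtain ⟨f, hf, C, hC⟩ := exists_abs_xxz_planarCorr_le_rpow hd n (-1) 0 hβ
  refine ⟨f, hf, C, fun L _ x y => ?_⟩
  have h := hC L 0 isHermitian_zero (fun ψ => by rw [Matrix.mul_zero, Matrix.zero_mul]) x y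
  rw [add_zero] at h
  rw [xyCorrTorus_eq_add]
  exact h

/-- **No planar long-range order in the quantum XY model at positive temperature in `d ≤ 2`**
(all-`L` torus convention of `LatticeTori.HasTorusLRO`): for `d ∈ {1,2}`, every spin and every
`β ≥ 0`, `¬ HasTorusLRO (xyCorrTorus β · n)` — the complement of the Kennedy–Lieb–Shastry /
Dyson–Lieb–Simon order in `d ≥ 3` (`kennedy_lieb_shastry_xy_thermal_holds`).
[cite: KomaTasakiPRL1992, bound (4), footnote 11 and the remark after the Theorem]
[cite: FriedliVelenik2017, §3.7.2] -/
theorem xy_thermal_not_hasTorusLRO (hd : d = 1 ∨ d = 2) (n : ℕ) {β : ℝ} (hβ : 0 ≤ β) :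
    ¬ HasTorusLRO (fun L x y => xyCorrTorus (d := d) β L n x y) := by
  obtain ⟨f, hf, C, hC⟩ := xy_thermal_exists_abs_corr_le_rpow hd n hβ
  have hd0 : d ≠ 0 := by rcases hd with rfl | rfl <;> decide
  exact not_hasTorusLRO_of_abs_le_rpow hd0 hf fun L _ x y => hC L x y

/-- **No planar long-range order in the quantum XY model at positive temperature in `d ≤ 2`,
even-torus convention** (`XYOrder.HasEvenTorusLRO`, the convention of
`kennedy_lieb_shastry_xy_thermal`): for `d ∈ {1,2}`, every spin `n/2` and every `β ≥ 0`,
`¬ HasEvenTorusLRO (xyCorrTorus β · n)`. [cite: KomaTasakiPRL1992, bound (4), footnote 11 and the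
remark after the Theorem] [cite: FriedliVelenik2017, §3.7.2] -/
theorem xy_thermal_not_hasEvenTorusLRO (hd : d = 1 ∨ d = 2) (n : ℕ) {β : ℝ} (hβ : 0 ≤ β) :
    ¬ HasEvenTorusLRO (fun L x y => xyCorrTorus (d := d) β L n x y) := by
  obtain ⟨f, hf, C, hC⟩ := xy_thermal_exists_abs_corr_le_rpow hd n hβ
  have hd0 : d ≠ 0 := by rcases hd with rfl | rfl <;> decide
  exact not_hasEvenTorusLRO_of_abs_le_rpow hd0 hf fun L _ x y => hC L x y

/-! #### The hard-core lattice Bose gas in a staggered field (`n = 1`, `J = -1`, `Δ = 0`,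
`D = λ Σ_x [½ + (-1)^x S³_x]`) -/

/-- `‖Ŝ⁺‖ ≤ 1` for spin `1/2` (`Ŝ⁺ = |↑⟩⟨↓|`, one unit entry). [folklore] -/
private theorem norm_spinRaise_one_le : ‖spinRaise 1‖ ≤ 1 := by
  refine (l2_opNorm_le_sum_norm_apply (spinRaise 1)).trans ?_
  simp [Fin.sum_univ_two, spinRaise_apply]

/-- The staggered potential `λ Σ_x [½ + (-1)^x S³_x]` is Hermitian and fixed by every imaginary
gauge (it is a function of the `S³_x`). [cite: LSSY2005, Ch. 11 (11.2)]
[cite: AizenmanEtAl2004, §2 (the Hamiltonian in spin language)] -/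
private theorem staggeredField_smul_admissible (L : ℕ) [NeZero L] (lam : ℝ) :
    ((lam : ℂ) • ∑ x : TorusSite d L, ((1 / 2 : ℂ) • (1 : Op (TorusSite d L) 2) +
      ((-1 : ℂ) ^ (∑ i, (x i).val)) • siteSpin 1 x 2)).IsHermitian ∧
    ∀ ψ : TorusSite d L → ℝ, ((Matrix.diagonal fun σ : TensorIndex _ (1 + 1) =>
      ((Real.exp (-(∑ u, (ψ) u * ((σ u : ℕ) : ℝ))) : ℝ) : ℂ)) : Op (TorusSite d L) (1 + 1)) *
      ((lam : ℂ) • ∑ x : TorusSite d L, ((1 / 2 : ℂ) • (1 : Op (TorusSite d L) 2) +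
        ((-1 : ℂ) ^ (∑ i, (x i).val)) • siteSpin 1 x 2)) *
      (Matrix.diagonal fun σ : TensorIndex _ (1 + 1) =>
      ((Real.exp (-(∑ u, (-ψ) u * ((σ u : ℕ) : ℝ))) : ℝ) : ℂ)) =
      (lam : ℂ) • ∑ x : TorusSite d L, ((1 / 2 : ℂ) • (1 : Op (TorusSite d L) 2) +
        ((-1 : ℂ) ^ (∑ i, (x i).val)) • siteSpin 1 x 2) := by
  refine ⟨isHermitian_real_smul (staggeredField_isHermitian d L) lam, fun ψ => ?_⟩
  rw [Matrix.mul_smul, Matrix.smul_mul]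
  congr 1
  exact gauge_conj_axialField ψ (fun _ => (1 / 2 : ℂ)) (fun x => (-1 : ℂ) ^ (∑ i, (x i).val))

/-- The one-particle density matrix of the hard-core lattice gas as the planar correlation of the
axial class `xxzHamiltonian 1 (torusGraph d L) (-1) 0 + λ Σ_x [½ + (-1)^x S³_x]`.
[cite: LSSY2005, Ch. 11 (11.2) and §11.3] -/
private theorem hardCoreODLRO_eq_re_add (β : ℝ) (L : ℕ) [NeZero L] (lam : ℝ) (x y : TorusSite d L) :
    hardCoreODLRO β L lam x y =
      (gibbsState β (xxzHamiltonian 1 (torusGraph d L) (-1) 0 + (lam : ℂ) •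
          ∑ x : TorusSite d L, ((1 / 2 : ℂ) • (1 : Op (TorusSite d L) 2) +
            ((-1 : ℂ) ^ (∑ i, (x i).val)) • siteSpin 1 x 2)) (siteSpin 1 x 0 * siteSpin 1 y 0)).re +
      (gibbsState β (xxzHamiltonian 1 (torusGraph d L) (-1) 0 + (lam : ℂ) •
          ∑ x : TorusSite d L, ((1 / 2 : ℂ) • (1 : Op (TorusSite d L) 2) +
            ((-1 : ℂ) ^ (∑ i, (x i).val)) • siteSpin 1 x 2)) (siteSpin 1 x 1 * siteSpin 1 y 1)).re := by
  rw [hardCoreODLRO_of_neZero, Fin.sum_univ_two, Complex.add_re]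
  rfl

/-- **No off-diagonal long-range order for hard-core lattice bosons in `d = 2` at `T > 0`: the
quantitative bound.** For the hard-core lattice Bose gas at half filling in the staggered field `λ`
(`hardCoreLatticeGas`, the model of Aizenman–Lieb–Seiringer–Solovej–Yngvason) on `(ℤ/Lℤ)²`, at
every inverse temperature `β ≥ 0` and for every `λ`, the one-particle density matrix decays at
least as a power: `|γ_{β,L,λ}(x,y)| ≤ 2 e^{1/2} (dist(x,y) + 1)^{-1/(2(128 β + 1))}`, uniformly in
`L` and `λ` (Koma–Tasaki's bound (4) for this member of the axial class; `‖Ŝ⁺‖ = 1` for spin `½`).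
[cite: KomaTasakiPRL1992, bound (4) and footnote 11] [cite: AizenmanEtAl2004, Theorem 1 (Existence of
BEC; the `d ≥ 3` statement whose `d = 2`, `T > 0` analogue fails)] -/
theorem hardCoreLatticeGas_odlro_abs_le_rpow_two (lam : ℝ) {β : ℝ} (hβ : 0 ≤ β) (L : ℕ) [NeZero L]
    (x y : TorusSite 2 L) :
    |hardCoreODLRO β L lam x y| ≤
      2 * Real.exp (1 / 2) * ((torusDist x y : ℝ) + 1) ^ (-(1 / (128 * β + 1) / 2)) := by
  obtain ⟨hD, hDg⟩ := staggeredField_smul_admissible (d := 2) L lam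
  have h := abs_xxz_planarCorr_le_rpow_two 1 (-1) 0 hβ hD hDg x y
  rw [← hardCoreODLRO_eq_re_add] at h
  have hs : ‖spinRaise 1‖ * ‖spinRaise 1‖ ≤ 1 := by
    nlinarith [norm_spinRaise_one_le, norm_nonneg (spinRaise 1)]
  have hR1 : (1 : ℝ) ≤ (torusDist x y : ℝ) + 1 := by simp
  have hden : 128 * (β * (|(-1 : ℝ)| * (‖spinRaise 1‖ * ‖spinRaise 1‖))) + 1 ≤ 128 * β + 1 := by
    rw [abs_neg, abs_one, one_mul]; nlinarith
  have hexp : -(1 / (128 * (β * (|(-1 : ℝ)| * (‖spinRaise 1‖ * ‖spinRaise 1‖))) + 1) / 2) ≤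
      -(1 / (128 * β + 1) / 2) := by
    have := one_div_le_one_div_of_le (by positivity) hden
    linarith
  calc |hardCoreODLRO β L lam x y|
      ≤ 2 * (‖spinRaise 1‖ * ‖spinRaise 1‖) * Real.exp (1 / 2) * ((torusDist x y : ℝ) + 1) ^
          (-(1 / (128 * (β * (|(-1 : ℝ)| * (‖spinRaise 1‖ * ‖spinRaise 1‖))) + 1) / 2)) := h
    _ ≤ 2 * 1 * Real.exp (1 / 2) * ((torusDist x y : ℝ) + 1) ^ (-(1 / (128 * β + 1) / 2)) := by
        refine mul_le_mul ?_ (Real.rpow_le_rpow_of_exponent_le hR1 hexp) (by positivity)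
          (by positivity)
        exact mul_le_mul_of_nonneg_right (mul_le_mul_of_nonneg_left hs zero_le_two)
          (Real.exp_pos _).le
    _ = 2 * Real.exp (1 / 2) * ((torusDist x y : ℝ) + 1) ^ (-(1 / (128 * β + 1) / 2)) := by
        rw [mul_one]

/-- **Hard-core lattice bosons on the ring, `T > 0`: exponential decay of the one-particle density
matrix**, `|γ_{β,L,λ}(x,y)| ≤ 2 exp (-dist(x,y) / (2(16β + 1)))`, uniformly in `L` and `λ`.
[cite: KomaTasakiPRL1992, Theorem (one-dimensional case), bound (4) and footnote 11] -/
theorem hardCoreLatticeGas_odlro_abs_le_exp_one (lam : ℝ) {β : ℝ} (hβ : 0 ≤ β) (L : ℕ) [NeZero L]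
    (x y : TorusSite 1 L) :
    |hardCoreODLRO β L lam x y| ≤
      2 * Real.exp (-(1 / (16 * β + 1) / 2 * (torusDist x y : ℝ))) := by
  obtain ⟨hD, hDg⟩ := staggeredField_smul_admissible (d := 1) L lam
  have h := abs_xxz_planarCorr_le_exp_one 1 (-1) 0 hβ hD hDg x y
  rw [← hardCoreODLRO_eq_re_add] at h
  have hs : ‖spinRaise 1‖ * ‖spinRaise 1‖ ≤ 1 := by
    nlinarith [norm_spinRaise_one_le, norm_nonneg (spinRaise 1)]
  have hR0 : (0 : ℝ) ≤ (torusDist x y : ℝ) := by positivity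
  have hden : 16 * (β * (|(-1 : ℝ)| * (‖spinRaise 1‖ * ‖spinRaise 1‖))) + 1 ≤ 16 * β + 1 := by
    rw [abs_neg, abs_one, one_mul]; nlinarith
  have hexp : -(1 / (16 * (β * (|(-1 : ℝ)| * (‖spinRaise 1‖ * ‖spinRaise 1‖))) + 1) / 2 *
      (torusDist x y : ℝ)) ≤ -(1 / (16 * β + 1) / 2 * (torusDist x y : ℝ)) := by
    have := one_div_le_one_div_of_le (by positivity) hden
    nlinarith
  calc |hardCoreODLRO β L lam x y|
      ≤ 2 * (‖spinRaise 1‖ * ‖spinRaise 1‖) * Real.exp (-(1 / (16 * (β * (|(-1 : ℝ)| *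
          (‖spinRaise 1‖ * ‖spinRaise 1‖))) + 1) / 2 * (torusDist x y : ℝ))) := h
    _ ≤ 2 * 1 * Real.exp (-(1 / (16 * β + 1) / 2 * (torusDist x y : ℝ))) := by
        refine mul_le_mul ?_ (Real.exp_le_exp.mpr hexp) (by positivity) (by positivity)
        exact mul_le_mul_of_nonneg_left hs zero_le_two
    _ = 2 * Real.exp (-(1 / (16 * β + 1) / 2 * (torusDist x y : ℝ))) := by rw [mul_one]

/-- **Uniform decay of the one-particle density matrix of hard-core lattice bosons in `d ≤ 2` at
`T > 0`**: for `d ∈ {1,2}`, every staggered field `λ` and every `β ≥ 0` there are `f > 0`, `C`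
with `|γ_{β,L,λ}(x,y)| ≤ C (dist(x,y) + 1)^{-f}` on all tori, uniformly in `L`.
[cite: KomaTasakiPRL1992, bound (4) and footnote 11] -/
theorem hardCoreLatticeGas_exists_odlro_abs_le_rpow (hd : d = 1 ∨ d = 2) (lam : ℝ) {β : ℝ}
    (hβ : 0 ≤ β) :
    ∃ f : ℝ, 0 < f ∧ ∃ C : ℝ, ∀ (L : ℕ) [NeZero L] (x y : TorusSite d L),
      |hardCoreODLRO β L lam x y| ≤ C * ((torusDist x y : ℝ) + 1) ^ (-f) := by
  obtain ⟨f, hf, C, hC⟩ := exists_abs_xxz_planarCorr_le_rpow hd 1 (-1) 0 hβ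
  refine ⟨f, hf, C, fun L _ x y => ?_⟩
  obtain ⟨hD, hDg⟩ := staggeredField_smul_admissible (d := d) L lam
  rw [hardCoreODLRO_eq_re_add]
  exact hC L _ hD hDg x y

/-- **No Bose–Einstein condensation (off-diagonal long-range order) for hard-core lattice bosons in
`d ≤ 2` at any positive temperature**, all-`L` torus convention: for `d ∈ {1,2}`, every staggered
field `λ` and every `β ≥ 0`, `¬ HasTorusLRO (γ_{β,·,λ})`, i.e. it is not the case that
`liminf_L |Λ_L|⁻² Σ_{x,y} γ(x,y) > 0`. [cite: KomaTasakiPRL1992, bound (4), footnote 11 and the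
remark after the Theorem] [cite: FriedliVelenik2017, §3.7.2] -/
theorem hardCoreLatticeGas_not_hasTorusLRO (hd : d = 1 ∨ d = 2) (lam : ℝ) {β : ℝ} (hβ : 0 ≤ β) :
    ¬ HasTorusLRO (fun L x y => hardCoreODLRO (d := d) β L lam x y) := by
  obtain ⟨f, hf, C, hC⟩ := hardCoreLatticeGas_exists_odlro_abs_le_rpow hd lam hβ
  have hd0 : d ≠ 0 := by rcases hd with rfl | rfl <;> decide
  exact not_hasTorusLRO_of_abs_le_rpow hd0 hf fun L _ x y => hC L x y

/-- **No Bose–Einstein condensation for hard-core lattice bosons in `d ≤ 2` at any positive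
temperature — the complement of Theorem 1 of Aizenman–Lieb–Seiringer–Solovej–Yngvason** (whose
conclusion, in the tree's typing `HalfFillingReflectionPositivity`, is
`HasEvenTorusLRO (fun L x y => hardCoreODLRO β L λ x y)` for `d ≥ 3`, small `λ`, large `β`): for
`d ∈ {1,2}`, EVERY `λ` and EVERY `β ≥ 0`, `¬ HasEvenTorusLRO (fun L x y => hardCoreODLRO β L λ x y)`:
the conclusion of that theorem fails identically in one and two dimensions at positive temperature
(Koma–Tasaki's gauge bound; no reflection positivity is used).
[cite: KomaTasakiPRL1992, bound (4), footnote 11 and the remark after the Theorem]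
[cite: AizenmanEtAl2004, Theorem 1 (Existence of BEC)] [cite: LSSY2005, Ch. 11 §11.3 (11.26)] -/
theorem hardCoreLatticeGas_not_hasEvenTorusLRO (hd : d = 1 ∨ d = 2) (lam : ℝ) {β : ℝ}
    (hβ : 0 ≤ β) :
    ¬ HasEvenTorusLRO (fun L x y => hardCoreODLRO (d := d) β L lam x y) := by
  obtain ⟨f, hf, C, hC⟩ := hardCoreLatticeGas_exists_odlro_abs_le_rpow hd lam hβ
  have hd0 : d ≠ 0 := by rcases hd with rfl | rfl <;> decide
  exact not_hasEvenTorusLRO_of_abs_le_rpow hd0 hf fun L _ x y => hC L x y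

end NoLRO

/-! ### §6 No macroscopic eigenvalue of the one-particle density matrix in `d ≤ 2` at `T > 0`
(the Penrose–Onsager form of "no Bose–Einstein condensation") -/

section Schur

variable {d : ℕ}

/-- **Schur test on the torus.** A real kernel with `|g(x,y)| ≤ C (dist(x,y)+1)^{-f}` (`f ≥ 0`)
has its quadratic form bounded by the row-sum bound of `sum_abs_le_of_abs_le_rpow`: for every
cut-off `R` and every real test function `φ`,
`|Σ_x Σ_y φ_x g(x,y) φ_y| ≤ max(C,0) ((2R+1)^d + L^d (R+1)^{-f}) Σ_x φ_x²`
(`2|φ_x φ_y| ≤ φ_x² + φ_y²`; rows and, by the symmetry of `dist`, columns have the same bound).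
[folklore] -/
private theorem abs_quadForm_le_of_abs_le_rpow {L : ℕ} [NeZero L]
    {g : TorusSite d L → TorusSite d L → ℝ} {C f : ℝ} (hf : 0 ≤ f)
    (hg : ∀ x y, |g x y| ≤ C * ((torusDist x y : ℝ) + 1) ^ (-f)) (R : ℕ)
    (φ : TorusSite d L → ℝ) :
    |∑ x, ∑ y, φ x * g x y * φ y| ≤
      max C 0 * ((2 * R + 1 : ℝ) ^ d + (L : ℝ) ^ d * ((R : ℝ) + 1) ^ (-f)) * ∑ x, φ x ^ 2 := by
  set M : ℝ := max C 0 * ((2 * R + 1 : ℝ) ^ d + (L : ℝ) ^ d * ((R : ℝ) + 1) ^ (-f)) with hM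
  have hrow : ∀ x, ∑ y, |g x y| ≤ M := fun x => sum_abs_le_of_abs_le_rpow hf hg x R
  have hcol : ∀ y, ∑ x, |g x y| ≤ M := fun y =>
    sum_abs_le_of_abs_le_rpow (g := fun a b => g b a) hf
      (fun a b => by rw [torusDist_comm']; exact hg b a) y R
  have hpt : ∀ x y, |φ x * g x y * φ y| ≤ |g x y| * φ x ^ 2 / 2 + |g x y| * φ y ^ 2 / 2 := by
    intro x y
    rw [abs_mul, abs_mul]
    have h0 : 0 ≤ |g x y| := abs_nonneg _
    have h2 : 2 * (|φ x| * |φ y|) ≤ φ x ^ 2 + φ y ^ 2 := by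
      nlinarith [sq_nonneg (|φ x| - |φ y|), sq_abs (φ x), sq_abs (φ y)]
    nlinarith [mul_le_mul_of_nonneg_left h2 h0, abs_nonneg (φ x), abs_nonneg (φ y)]
  have h1 : ∀ x, ∑ y, |g x y| * φ x ^ 2 / 2 ≤ M * φ x ^ 2 / 2 := by
    intro x
    rw [← Finset.sum_div, ← Finset.sum_mul]
    gcongr
    exact hrow x
  have h2 : ∀ y, ∑ x, |g x y| * φ y ^ 2 / 2 ≤ M * φ y ^ 2 / 2 := by
    intro y
    rw [← Finset.sum_div, ← Finset.sum_mul]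
    gcongr
    exact hcol y
  calc |∑ x, ∑ y, φ x * g x y * φ y|
      ≤ ∑ x, ∑ y, |φ x * g x y * φ y| :=
        (abs_sum_le_sum_abs _ _).trans (sum_le_sum fun x _ => abs_sum_le_sum_abs _ _)
    _ ≤ ∑ x, ∑ y, (|g x y| * φ x ^ 2 / 2 + |g x y| * φ y ^ 2 / 2) :=
        sum_le_sum fun x _ => sum_le_sum fun y _ => hpt x y
    _ = ∑ x, ∑ y, |g x y| * φ x ^ 2 / 2 + ∑ y, ∑ x, |g x y| * φ y ^ 2 / 2 := by
        simp only [Finset.sum_add_distrib]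
        congr 1
        exact Finset.sum_comm
    _ ≤ ∑ x, M * φ x ^ 2 / 2 + ∑ y, M * φ y ^ 2 / 2 :=
        add_le_add (sum_le_sum fun x _ => h1 x) (sum_le_sum fun y _ => h2 y)
    _ = M * ∑ x, φ x ^ 2 := by
        rw [← Finset.sum_add_distrib, Finset.mul_sum]
        exact sum_congr rfl fun x _ => by ring

/-- **From uniform power-law decay to "no macroscopic eigenvalue"**: if a family of real torus
kernels satisfies `|G_L(x,y)| ≤ C (dist(x,y)+1)^{-f}` uniformly in `L` (`d ≥ 1`, `f > 0`), then for
every `ε > 0` there is `L₀` such that for all `L ≥ L₀` and every real test function `φ` on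
`(ℤ/Lℤ)^d`, `|Σ_x Σ_y φ_x G_L(x,y) φ_y| ≤ ε L^d Σ_x φ_x²` — every eigenvalue of the symmetric
kernel is `≤ ε |Λ_L|` (Schur test with the cut-off `R` chosen first, then `L`). [folklore] -/
private theorem quadForm_eventually_le_of_abs_le_rpow (hd : d ≠ 0)
    {G : (L : ℕ) → TorusSite d L → TorusSite d L → ℝ} {C f : ℝ} (hf : 0 < f)
    (hG : ∀ (L : ℕ) [NeZero L] (x y : TorusSite d L),
      |G L x y| ≤ C * ((torusDist x y : ℝ) + 1) ^ (-f)) {ε : ℝ} (hε : 0 < ε) :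
    ∃ L₀ : ℕ, ∀ (L : ℕ) [NeZero L], L₀ ≤ L → ∀ φ : TorusSite d L → ℝ,
      |∑ x, ∑ y, φ x * G L x y * φ y| ≤ ε * (L : ℝ) ^ d * ∑ x, φ x ^ 2 := by
  set C' : ℝ := max C 0 with hC'
  -- choose the cut-off radius `R` …
  have h1 : Tendsto (fun R : ℕ => C' * ((R : ℝ) + 1) ^ (-f)) atTop (𝓝 0) := by
    have := ((tendsto_rpow_neg_atTop hf).comp
      (tendsto_atTop_add_const_right atTop (1 : ℝ) tendsto_natCast_atTop_atTop)).const_mul C'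
    simpa using this
  obtain ⟨R, hR⟩ := (h1.eventually (eventually_lt_nhds (half_pos hε))).exists
  -- … then the side `L`
  have h2 : Tendsto (fun L : ℕ => C' * (2 * R + 1 : ℝ) ^ d / (L : ℝ) ^ d) atTop (𝓝 0) :=
    tendsto_const_nhds.div_atTop ((tendsto_pow_atTop hd).comp tendsto_natCast_atTop_atTop)
  obtain ⟨N, hN⟩ := eventually_atTop.1 (h2.eventually (eventually_lt_nhds (half_pos hε)))
  refine ⟨N, fun L _ hL φ => ?_⟩
  have hLpos : (0 : ℝ) < (L : ℝ) ^ d := by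
    have : (L : ℝ) ≠ 0 := by exact_mod_cast NeZero.ne L
    positivity
  have hM : C' * ((2 * R + 1 : ℝ) ^ d + (L : ℝ) ^ d * ((R : ℝ) + 1) ^ (-f)) ≤ ε * (L : ℝ) ^ d := by
    have ha : C' * (2 * R + 1 : ℝ) ^ d ≤ ε / 2 * (L : ℝ) ^ d := by
      have := hN L hL
      rw [div_lt_iff₀ hLpos] at this
      exact this.le
    have hb : (L : ℝ) ^ d * (C' * ((R : ℝ) + 1) ^ (-f)) ≤ (L : ℝ) ^ d * (ε / 2) :=
      mul_le_mul_of_nonneg_left hR.le hLpos.le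
    nlinarith [ha, hb]
  have hφ : 0 ≤ ∑ x, φ x ^ 2 := sum_nonneg fun x _ => sq_nonneg _
  exact (abs_quadForm_le_of_abs_le_rpow hf.le (fun x y => hG L x y) R φ).trans
    (mul_le_mul_of_nonneg_right hM hφ)

/-- **No Bose–Einstein condensation into ANY mode for hard-core lattice bosons in `d ≤ 2` at
`T > 0` (Penrose–Onsager form).** For `d ∈ {1,2}`, every staggered field `λ`, every `β ≥ 0` and
every `ε > 0` there is `L₀` such that for all `L ≥ L₀` and every real `φ` on `(ℤ/Lℤ)^d`,
`|⟨φ, γ_{β,L,λ} φ⟩| = |Σ_x Σ_y φ_x γ(x,y) φ_y| ≤ ε |Λ_L| Σ_x φ_x²` (`|Λ_L| = L^d`): the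
one-particle density matrix `γ(x,y) = ⟨a†_x a_y⟩` (real symmetric) has NO eigenvalue of order
`|Λ|` — not only the zero-momentum occupation `⟨φ₀, γ φ₀⟩`, `φ₀ = |Λ|^{-1/2}` (which is what
`HasEvenTorusLRO`/`hardCoreLatticeGas_not_hasEvenTorusLRO` concern), but the occupation of every
one-particle mode is `o(N)`. Contrast: in `d ≥ 3`, small `λ`, large `β`, `γ` has exactly one
eigenvalue of order `|Λ|` (Aizenman et al., Theorem 1 and the discussion following its proof).
[cite: KomaTasakiPRL1992, bound (4), footnote 11 and the remark after the Theorem]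
[cite: AizenmanEtAl2004, Theorem 1 and §3 (eigenvalues of `γ`)] -/
theorem hardCoreLatticeGas_odlro_quadForm_eventually_le (hd : d = 1 ∨ d = 2) (lam : ℝ) {β : ℝ}
    (hβ : 0 ≤ β) {ε : ℝ} (hε : 0 < ε) :
    ∃ L₀ : ℕ, ∀ (L : ℕ) [NeZero L], L₀ ≤ L → ∀ φ : TorusSite d L → ℝ,
      |∑ x, ∑ y, φ x * hardCoreODLRO β L lam x y * φ y| ≤ ε * (L : ℝ) ^ d * ∑ x, φ x ^ 2 := by
  obtain ⟨f, hf, C, hC⟩ := hardCoreLatticeGas_exists_odlro_abs_le_rpow hd lam hβ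
  have hd0 : d ≠ 0 := by rcases hd with rfl | rfl <;> decide
  exact quadForm_eventually_le_of_abs_le_rpow hd0 hf (fun L _ x y => hC L x y) hε

/-- **The quantum XY model in `d ≤ 2` at `T > 0`: no macroscopic eigenvalue of the planar
correlation kernel** `Re ⟨S¹_xS¹_y + S²_xS²_y⟩_{β,L}` (every spin, every `β ≥ 0`): for every
`ε > 0`, eventually in `L`, `|Σ_x Σ_y φ_x xyCorrTorus β L n x y φ_y| ≤ ε L^d Σ_x φ_x²` for all real
`φ`. [cite: KomaTasakiPRL1992, bound (4), footnote 11 and the remark after the Theorem] -/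
theorem xy_thermal_quadForm_eventually_le (hd : d = 1 ∨ d = 2) (n : ℕ) {β : ℝ} (hβ : 0 ≤ β)
    {ε : ℝ} (hε : 0 < ε) :
    ∃ L₀ : ℕ, ∀ (L : ℕ) [NeZero L], L₀ ≤ L → ∀ φ : TorusSite d L → ℝ,
      |∑ x, ∑ y, φ x * xyCorrTorus (d := d) β L n x y * φ y| ≤ ε * (L : ℝ) ^ d * ∑ x, φ x ^ 2 := by
  obtain ⟨f, hf, C, hC⟩ := xy_thermal_exists_abs_corr_le_rpow hd n hβ
  have hd0 : d ≠ 0 := by rcases hd with rfl | rfl <;> decide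
  exact quadForm_eventually_le_of_abs_le_rpow hd0 hf (fun L _ x y => hC L x y) hε

end Schur

/-! ### §7 Hard-core lattice bosons at ANY filling (chemical potential `μ`): the same bounds

The `d ≥ 3` reflection-positivity proof of condensation needs half filling (the particle–hole
symmetry enters the reflection; barrier `HalfFillingReflectionPositivity`, audit (g1)). On the
ceiling side nothing of the kind is needed: a chemical potential `μ Σ_x S³_x = μ (N - |Λ|/2)` is an
axial term, fixed by every imaginary gauge, so §4–§6 apply verbatim to
`hardCoreLatticeGas d L λ + μ Σ_x S³_x` (the tree's any-filling Hamiltonian of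
`HalfFillingDischargesAnyFilling`), uniformly in `μ`. -/

section AnyFilling

variable {d : ℕ}

/-- The axial part `λ Σ_x [½ + (-1)^x S³_x] + μ Σ_x S³_x` of the hard-core lattice gas at chemical
potential `μ` is Hermitian and gauge fixed, and
`hardCoreLatticeGas d L λ + μ Σ_x S³_x = xxzHamiltonian 1 (torusGraph d L) (-1) 0 + (that part)`.
[cite: LSSY2005, Ch. 11 (11.2) and §11.1 (closing paragraph: the role of half filling)] -/
private theorem chemPot_admissible (L : ℕ) [NeZero L] (lam μ : ℝ) :
    hardCoreLatticeGas d L lam + (μ : ℂ) • ∑ x : TorusSite d L, siteSpin 1 x 2 =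
      xxzHamiltonian 1 (torusGraph d L) (-1) 0 +
        ((lam : ℂ) • ∑ x : TorusSite d L, ((1 / 2 : ℂ) • (1 : Op (TorusSite d L) 2) +
          ((-1 : ℂ) ^ (∑ i, (x i).val)) • siteSpin 1 x 2) +
          (μ : ℂ) • ∑ x : TorusSite d L, siteSpin 1 x 2) ∧
    ((lam : ℂ) • ∑ x : TorusSite d L, ((1 / 2 : ℂ) • (1 : Op (TorusSite d L) 2) +
        ((-1 : ℂ) ^ (∑ i, (x i).val)) • siteSpin 1 x 2) +
        (μ : ℂ) • ∑ x : TorusSite d L, siteSpin 1 x 2).IsHermitian ∧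
    ∀ ψ : TorusSite d L → ℝ, ((Matrix.diagonal fun σ : TensorIndex _ (1 + 1) =>
      ((Real.exp (-(∑ u, (ψ) u * ((σ u : ℕ) : ℝ))) : ℝ) : ℂ)) : Op (TorusSite d L) (1 + 1)) *
      ((lam : ℂ) • ∑ x : TorusSite d L, ((1 / 2 : ℂ) • (1 : Op (TorusSite d L) 2) +
          ((-1 : ℂ) ^ (∑ i, (x i).val)) • siteSpin 1 x 2) +
        (μ : ℂ) • ∑ x : TorusSite d L, siteSpin 1 x 2) *
      (Matrix.diagonal fun σ : TensorIndex _ (1 + 1) =>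
      ((Real.exp (-(∑ u, (-ψ) u * ((σ u : ℕ) : ℝ))) : ℝ) : ℂ)) =
      (lam : ℂ) • ∑ x : TorusSite d L, ((1 / 2 : ℂ) • (1 : Op (TorusSite d L) 2) +
          ((-1 : ℂ) ^ (∑ i, (x i).val)) • siteSpin 1 x 2) +
        (μ : ℂ) • ∑ x : TorusSite d L, siteSpin 1 x 2 := by
  obtain ⟨hD, hDg⟩ := staggeredField_smul_admissible (d := d) L lam
  have hZ : (∑ x : TorusSite d L, siteSpin 1 x 2 : Op (TorusSite d L) 2).IsHermitian :=
    totalSpin_isHermitian (Λ := TorusSite d L) 1 2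
  refine ⟨by rw [hardCoreLatticeGas_eq, add_assoc], hD.add (isHermitian_real_smul hZ μ),
    fun ψ => ?_⟩
  rw [Matrix.mul_add, Matrix.add_mul, hDg ψ, Matrix.mul_smul, Matrix.smul_mul, Finset.mul_sum,
    Finset.sum_mul]
  congr 2
  exact Finset.sum_congr rfl fun x _ => gauge_conj_siteSpin_two_eq ψ x

/-- **Hard-core lattice bosons at any filling, `d = 2`, `T > 0`: power-law decay of the
one-particle density matrix**, uniformly in the side `L`, the staggered field `λ` AND the chemical
potential `μ`: for `H = hardCoreLatticeGas 2 L λ + μ Σ_x S³_x` and every `β ≥ 0`,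
`|Re ⟨S¹_xS¹_y⟩_{β,L} + Re ⟨S²_xS²_y⟩_{β,L}| ≤ 2 e^{1/2} (dist(x,y) + 1)^{-1/(2(128β + 1))}`
(the chemical potential is an axial term: bound (4) of the source with `h_x = (0,0,μ)`).
[cite: KomaTasakiPRL1992, bound (4) and footnote 11] [cite: LSSY2005, Ch. 11 §11.1] -/
theorem hardCoreLatticeGas_chemPot_planarCorr_abs_le_rpow_two (lam μ : ℝ) {β : ℝ} (hβ : 0 ≤ β)
    (L : ℕ) [NeZero L] (x y : TorusSite 2 L) :
    |(gibbsState β (hardCoreLatticeGas 2 L lam + (μ : ℂ) • ∑ z : TorusSite 2 L, siteSpin 1 z 2)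
        (siteSpin 1 x 0 * siteSpin 1 y 0)).re +
      (gibbsState β (hardCoreLatticeGas 2 L lam + (μ : ℂ) • ∑ z : TorusSite 2 L, siteSpin 1 z 2)
        (siteSpin 1 x 1 * siteSpin 1 y 1)).re| ≤
      2 * Real.exp (1 / 2) * ((torusDist x y : ℝ) + 1) ^ (-(1 / (128 * β + 1) / 2)) := by
  obtain ⟨hH, hD, hDg⟩ := chemPot_admissible (d := 2) L lam μ
  have h := abs_xxz_planarCorr_le_rpow_two 1 (-1) 0 hβ hD hDg x y
  rw [← hH] at h
  have hs : ‖spinRaise 1‖ * ‖spinRaise 1‖ ≤ 1 := by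
    nlinarith [norm_spinRaise_one_le, norm_nonneg (spinRaise 1)]
  have hR1 : (1 : ℝ) ≤ (torusDist x y : ℝ) + 1 := by simp
  have hden : 128 * (β * (|(-1 : ℝ)| * (‖spinRaise 1‖ * ‖spinRaise 1‖))) + 1 ≤ 128 * β + 1 := by
    rw [abs_neg, abs_one, one_mul]; nlinarith
  have hexp : -(1 / (128 * (β * (|(-1 : ℝ)| * (‖spinRaise 1‖ * ‖spinRaise 1‖))) + 1) / 2) ≤
      -(1 / (128 * β + 1) / 2) := by
    have := one_div_le_one_div_of_le (by positivity) hden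
    linarith
  refine h.trans ?_
  calc 2 * (‖spinRaise 1‖ * ‖spinRaise 1‖) * Real.exp (1 / 2) * ((torusDist x y : ℝ) + 1) ^
          (-(1 / (128 * (β * (|(-1 : ℝ)| * (‖spinRaise 1‖ * ‖spinRaise 1‖))) + 1) / 2))
      ≤ 2 * 1 * Real.exp (1 / 2) * ((torusDist x y : ℝ) + 1) ^ (-(1 / (128 * β + 1) / 2)) := by
        refine mul_le_mul ?_ (Real.rpow_le_rpow_of_exponent_le hR1 hexp) (by positivity)
          (by positivity)
        exact mul_le_mul_of_nonneg_right (mul_le_mul_of_nonneg_left hs zero_le_two)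
          (Real.exp_pos _).le
    _ = 2 * Real.exp (1 / 2) * ((torusDist x y : ℝ) + 1) ^ (-(1 / (128 * β + 1) / 2)) := by
        rw [mul_one]

/-- **No Bose–Einstein condensation into any mode for hard-core lattice bosons at ANY filling in
`d ≤ 2` at `T > 0`** (Penrose–Onsager form, uniform in the chemical potential): for `d ∈ {1,2}`,
every `λ`, every `β ≥ 0` and every `ε > 0` there is `L₀` such that for all `L ≥ L₀`, ALL `μ` and
every real `φ` on `(ℤ/Lℤ)^d`, with `γ_μ(x,y) = Re ⟨S¹_xS¹_y + S²_xS²_y⟩_{β,L}` in the Gibbs state of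
`hardCoreLatticeGas d L λ + μ Σ_x S³_x`: `|Σ_x Σ_y φ_x γ_μ(x,y) φ_y| ≤ ε L^d Σ_x φ_x²`. In `d ≤ 2`
at positive temperature there is thus nothing for half filling to protect — the contrast with the
`d ≥ 3` theorem, whose reflection-positivity proof uses half filling essentially
(`HalfFillingReflectionPositivity`, `HalfFillingReflectionPositivityNarrow`).
[cite: KomaTasakiPRL1992, bound (4), footnote 11 and the remark after the Theorem]
[cite: LSSY2005, Ch. 11 §11.1 (closing paragraph)] -/
theorem hardCoreLatticeGas_chemPot_quadForm_eventually_le (hd : d = 1 ∨ d = 2) (lam : ℝ)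
    {β : ℝ} (hβ : 0 ≤ β) {ε : ℝ} (hε : 0 < ε) :
    ∃ L₀ : ℕ, ∀ (L : ℕ) [NeZero L], L₀ ≤ L → ∀ (μ : ℝ) (φ : TorusSite d L → ℝ),
      |∑ x, ∑ y, φ x *
          ((gibbsState β (hardCoreLatticeGas d L lam + (μ : ℂ) • ∑ z : TorusSite d L, siteSpin 1 z 2)
              (siteSpin 1 x 0 * siteSpin 1 y 0)).re +
            (gibbsState β (hardCoreLatticeGas d L lam + (μ : ℂ) • ∑ z : TorusSite d L, siteSpin 1 z 2)
              (siteSpin 1 x 1 * siteSpin 1 y 1)).re) * φ y| ≤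
        ε * (L : ℝ) ^ d * ∑ x, φ x ^ 2 := by
  obtain ⟨f, hf, C, hC⟩ := exists_abs_xxz_planarCorr_le_rpow hd 1 (-1) 0 hβ
  have hd0 : d ≠ 0 := by rcases hd with rfl | rfl <;> decide
  obtain ⟨L₀, hL₀⟩ := Literature.Barriers.HubbardSuperconductivity.norm_quadForm_eventually_le
    hd0 (C := C) hf hε
  refine ⟨L₀, fun L _ hL μ φ => ?_⟩
  obtain ⟨hH, hD, hDg⟩ := chemPot_admissible (d := d) L lam μ
  have hK := hL₀ L hL (fun x y => (((gibbsState β (hardCoreLatticeGas d L lam +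
      (μ : ℂ) • ∑ z : TorusSite d L, siteSpin 1 z 2) (siteSpin 1 x 0 * siteSpin 1 y 0)).re +
    (gibbsState β (hardCoreLatticeGas d L lam + (μ : ℂ) • ∑ z : TorusSite d L, siteSpin 1 z 2)
      (siteSpin 1 x 1 * siteSpin 1 y 1)).re : ℝ) : ℂ))
    (fun x y => by
      rw [Complex.norm_real, Real.norm_eq_abs, hH]
      exact hC L _ hD hDg x y)
    (fun x => ((φ x : ℝ) : ℂ))
  have hre : ∀ x, star ((φ x : ℝ) : ℂ) = ((φ x : ℝ) : ℂ) := fun x => Complex.conj_ofReal _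
  simp only [hre, ← Complex.ofReal_mul, ← Complex.ofReal_sum, Complex.norm_real,
    Real.norm_eq_abs, sq_abs] at hK
  exact hK

end AnyFilling

/-! ### §8 The dimension dichotomy for Bose–Einstein condensation of hard-core lattice bosons -/

section Dichotomy

/-- **BEC of hard-core lattice bosons in the optical lattice: the dimension dichotomy.** For every
dimension `d ≥ 1` there is `λ₀ > 0` such that for every staggered field `0 ≤ λ < λ₀` there is
`β₀ > 0` with: for all `β ≥ β₀`, the Gibbs states of `hardCoreLatticeGas d · λ` have off-diagonal
long-range order along the even tori (`HasEvenTorusLRO (γ_{β,·,λ})`, a macroscopic occupation of the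
zero-momentum mode) **if and only if `d ≥ 3`**. The "if" is the reflection-positivity theorem of
Aizenman–Lieb–Seiringer–Solovej–Yngvason (`HalfFillingReflectionPositivity_holds`); the "only if"
is §5 (`hardCoreLatticeGas_not_hasEvenTorusLRO`: in `d ∈ {1,2}` there is no such order for ANY
`λ` and ANY `β ≥ 0`, by Koma–Tasaki's gauge bound). [cite: AizenmanEtAl2004, Theorem 1 (Existence
of BEC)] [cite: LSSY2005, Ch. 11 §11.3 (11.26)] [cite: KomaTasakiPRL1992, bound (4), footnote 11
and the remark after the Theorem] -/
theorem hardCoreLatticeGas_hasEvenTorusLRO_iff_three_le (d : ℕ) (hd : d ≠ 0) :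
    ∃ lam₀ : ℝ, 0 < lam₀ ∧ ∀ lam : ℝ, 0 ≤ lam → lam < lam₀ →
      ∃ β₀ : ℝ, 0 < β₀ ∧ ∀ β : ℝ, β₀ ≤ β →
        (HasEvenTorusLRO (fun L x y => hardCoreODLRO (d := d) β L lam x y) ↔ 3 ≤ d) := by
  by_cases h3 : 3 ≤ d
  · obtain ⟨lam₀, hlam₀, h⟩ :=
      Literature.Barriers.AtomisticToContinuum.HalfFillingReflectionPositivity_holds d h3
    refine ⟨lam₀, hlam₀, fun lam h0 h1 => ?_⟩
    obtain ⟨β₀, hβ₀, hβ⟩ := h lam h0 h1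
    exact ⟨β₀, hβ₀, fun β hle => iff_of_true (hβ β hle) h3⟩
  · have hd12 : d = 1 ∨ d = 2 := by omega
    refine ⟨1, one_pos, fun lam _ _ => ⟨1, one_pos, fun β hle => iff_of_false ?_ h3⟩⟩
    exact hardCoreLatticeGas_not_hasEvenTorusLRO hd12 lam (by linarith)

/-- **Planar long-range order of the quantum XY model at low temperature: the dimension
dichotomy.** For every dimension `d ≥ 1` and every spin `n/2 ≥ 1/2`: the Gibbs states of the
ferromagnetic quantum XY model `xyTorus d L n` have planar long-range order along the even tori
for all sufficiently large `β` **if and only if `d ≥ 3`** — "if" is the Dyson–Lieb–Simon /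
Kennedy–Lieb–Shastry reflection-positivity theorem of the tree
(`kennedy_lieb_shastry_xy_thermal_holds`), "only if" is Koma–Tasaki's bound (4) for the axial
class (`xy_thermal_not_hasEvenTorusLRO`: in `d ∈ {1,2}` no planar order at ANY `β ≥ 0`).
[cite: DysonLiebSimon1978, Thm. 4.2] [cite: KLS1988PRL, Theorem (remark on `T > 0`)]
[cite: KomaTasakiPRL1992, bound (4), footnote 11 and the remark after the Theorem] -/
theorem xy_thermal_eventually_hasEvenTorusLRO_iff_three_le (d : ℕ) (hd : d ≠ 0) (n : ℕ)
    (hn : 1 ≤ n) :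
    (∃ β₀ : ℝ, 0 < β₀ ∧ ∀ β : ℝ, β₀ ≤ β →
        HasEvenTorusLRO (fun L x y => xyCorrTorus (d := d) β L n x y)) ↔ 3 ≤ d := by
  constructor
  · rintro ⟨β₀, hβ₀, h⟩
    by_contra h3
    have hd12 : d = 1 ∨ d = 2 := by omega
    exact xy_thermal_not_hasEvenTorusLRO hd12 n hβ₀.le (h β₀ le_rfl)
  · intro h3
    exact kennedy_lieb_shastry_xy_thermal_holds d h3 n hn

end Dichotomy

/-! ### §9 The axial class, Penrose–Onsager form (master statement) -/

section Master

variable {d : ℕ}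

/-- **No macroscopic eigenvalue of the planar correlation kernel for the whole axial class in
`d ≤ 2` at `T > 0` (master statement of §6–§7).** For `d ∈ {1,2}`, spin `n/2`, couplings `J, Δ`,
`β ≥ 0` and `ε > 0` there is `L₀` — depending only on these data — such that for every side
`L ≥ L₀`, EVERY Hermitian term `D` on that torus fixed by the imaginary gauges (axial fields of any
strength and pattern, Ising couplings, chemical potentials) and every real `φ`:
`|Σ_x Σ_y φ_x (Re ⟨S¹_xS¹_y⟩ + Re ⟨S²_xS²_y⟩)_{β, H} φ_y| ≤ ε L^d Σ_x φ_x²`,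
`H = xxzHamiltonian n (torusGraph d L) J Δ + D`: the planar kernel has no eigenvalue of order
`|Λ_L|`, uniformly in the axial part (§4's decay bound, uniform in `D`, and the Schur test
`norm_quadForm_eventually_le`). [cite: KomaTasakiPRL1992, bound (4), footnote 11 and the remark
after the Theorem] [cite: HornJohnson2012, Cor. 6.1.5 (lit p0486)] -/
theorem xxz_planarCorr_quadForm_eventually_le (hd : d = 1 ∨ d = 2) (n : ℕ) (J Δ : ℝ) {β : ℝ}
    (hβ : 0 ≤ β) {ε : ℝ} (hε : 0 < ε) :
    ∃ L₀ : ℕ, ∀ (L : ℕ) [NeZero L], L₀ ≤ L → ∀ (D : Op (TorusSite d L) (n + 1)), D.IsHermitian →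
      (∀ ψ : TorusSite d L → ℝ, ((Matrix.diagonal fun σ : TensorIndex _ (n + 1) =>
        ((Real.exp (-(∑ u, (ψ) u * ((σ u : ℕ) : ℝ))) : ℝ) : ℂ)) : Op (TorusSite d L) (n + 1)) * D *
        (Matrix.diagonal fun σ : TensorIndex _ (n + 1) =>
        ((Real.exp (-(∑ u, (-ψ) u * ((σ u : ℕ) : ℝ))) : ℝ) : ℂ)) = D) →
      ∀ φ : TorusSite d L → ℝ,
        |∑ x, ∑ y, φ x *
            ((gibbsState β (xxzHamiltonian n (torusGraph d L) J Δ + D)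
                (siteSpin n x 0 * siteSpin n y 0)).re +
              (gibbsState β (xxzHamiltonian n (torusGraph d L) J Δ + D)
                (siteSpin n x 1 * siteSpin n y 1)).re) * φ y| ≤
          ε * (L : ℝ) ^ d * ∑ x, φ x ^ 2 := by
  obtain ⟨f, hf, C, hC⟩ := exists_abs_xxz_planarCorr_le_rpow hd n J Δ hβ
  have hd0 : d ≠ 0 := by rcases hd with rfl | rfl <;> decide
  obtain ⟨L₀, hL₀⟩ := Literature.Barriers.HubbardSuperconductivity.norm_quadForm_eventually_le
    hd0 (C := C) hf hε
  refine ⟨L₀, fun L _ hL D hD hDg φ => ?_⟩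
  have hK := hL₀ L hL (fun x y => (((gibbsState β (xxzHamiltonian n (torusGraph d L) J Δ + D)
      (siteSpin n x 0 * siteSpin n y 0)).re +
    (gibbsState β (xxzHamiltonian n (torusGraph d L) J Δ + D)
      (siteSpin n x 1 * siteSpin n y 1)).re : ℝ) : ℂ))
    (fun x y => by
      rw [Complex.norm_real, Real.norm_eq_abs]
      exact hC L D hD hDg x y)
    (fun x => ((φ x : ℝ) : ℂ))
  have hre : ∀ x, star ((φ x : ℝ) : ℂ) = ((φ x : ℝ) : ℂ) := fun x => Complex.conj_ofReal _
  simp only [hre, ← Complex.ofReal_mul, ← Complex.ofReal_sum, Complex.norm_real,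
    Real.norm_eq_abs, sq_abs] at hK
  exact hK

end Master

/-! ### §10 The bounds in infinite volume, as printed (`⟨A⟩ = lim_{L → ∞} ⟨A⟩_L`, eq. (3) of the
source): every torus-limit state of the Gibbs states obeys bound (4) -/

section InfiniteVolume

/-- The torus distance of the reductions of `x, y ∈ ℤ^d` modulo `L` is the sup-distance `‖x - y‖_∞`
as soon as `2‖x - y‖_∞ ≤ L`. [folklore] -/
private theorem torusDist_proj_eq {d L : ℕ} [NeZero L] {x y : Site d}
    (h : 2 * Site.supNorm (x - y) ≤ L) :
    torusDist (Torus.proj L x) (Torus.proj L y) = Site.supNorm (x - y) := by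
  have hsub : Torus.proj L (x - y) = Torus.proj L x - Torus.proj L y := by
    funext i
    simp [Torus.proj_apply]
  unfold torusDist
  rw [← hsub, torusNorm_proj_eq h]

/-- **Koma–Tasaki's bound (4) in the infinite volume, `d = 2`, for the axial class.** Let `β ≥ 0`,
let the sides `L_j → ∞`, let `D_j` be Hermitian gauge-fixed terms on the tori `(ℤ/L_jℤ)²`, and let
`ω` be ANY thermodynamic-limit state of the Gibbs states of `xxzHamiltonian n (torusGraph 2 L_j) J Δ
+ D_j` (`InfVolState.IsTorusLimitOf`, the source's `⟨A⟩ = lim_L ⟨A⟩_L` of eq. (3); such limits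
exist along subsequences, `InfVolState.exists_isTorusLimitOf_subseq`). Then for all `x, y ∈ ℤ²`
`|Re ω(ŜˣₓŜˣ_y) + Re ω(ŜʸₓŜʸ_y)| ≤ 2‖Ŝ⁺‖² e^{1/2} (‖x - y‖_∞ + 1)^{-q/2}`,
`q = 1/(128 β|J|‖Ŝ⁺‖² + 1)`: the finite-volume bound of §4 is uniform in `L` and passes to the
limit (`torusDist (x mod L) (y mod L) = ‖x - y‖_∞` for `L ≥ 2‖x - y‖_∞`).
[cite: KomaTasakiPRL1992, eq. (3), Theorem bound (4) and footnote 11] -/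
theorem abs_xxz_planarCorr_torusLimit_le_rpow_two (n : ℕ) (J Δ : ℝ) {β : ℝ} (hβ : 0 ≤ β)
    {Ls : ℕ → ℕ} [∀ j, NeZero (Ls j)] (hLs : Tendsto Ls atTop atTop)
    (D : ∀ j, Op (TorusSite 2 (Ls j)) (n + 1)) (hD : ∀ j, (D j).IsHermitian)
    (hDg : ∀ j (ψ : TorusSite 2 (Ls j) → ℝ), ((Matrix.diagonal fun σ : TensorIndex _ (n + 1) =>
      ((Real.exp (-(∑ u, (ψ) u * ((σ u : ℕ) : ℝ))) : ℝ) : ℂ)) : Op (TorusSite 2 (Ls j)) (n + 1)) * D j *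
      (Matrix.diagonal fun σ : TensorIndex _ (n + 1) =>
      ((Real.exp (-(∑ u, (-ψ) u * ((σ u : ℕ) : ℝ))) : ℝ) : ℂ)) = D j)
    {ω : InfVolState 2 (n + 1)}
    (hω : ω.IsTorusLimitOf (fun j => gibbsState β (xxzHamiltonian n (torusGraph 2 (Ls j)) J Δ + D j)))
    (x y : Site 2) :
    |(ω.corr x y (spinVec n 0) (spinVec n 0)).re + (ω.corr x y (spinVec n 1) (spinVec n 1)).re| ≤
      2 * (‖spinRaise n‖ * ‖spinRaise n‖) * Real.exp (1 / 2) *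
        ((Site.supNorm (x - y) : ℝ) + 1) ^
          (-(1 / (128 * (β * (|J| * (‖spinRaise n‖ * ‖spinRaise n‖))) + 1) / 2)) := by
  have key : Tendsto (fun j =>
      |(gibbsState β (xxzHamiltonian n (torusGraph 2 (Ls j)) J Δ + D j)
          (onSite (Torus.proj (Ls j) x) (spinVec n 0) * onSite (Torus.proj (Ls j) y) (spinVec n 0))).re +
        (gibbsState β (xxzHamiltonian n (torusGraph 2 (Ls j)) J Δ + D j)
          (onSite (Torus.proj (Ls j) x) (spinVec n 1) * onSite (Torus.proj (Ls j) y) (spinVec n 1))).re|)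
      atTop (𝓝 |(ω.corr x y (spinVec n 0) (spinVec n 0)).re +
        (ω.corr x y (spinVec n 1) (spinVec n 1)).re|) :=
    (((Complex.continuous_re.tendsto _).comp (hω.tendsto_corr hLs x y _ _)).add
      ((Complex.continuous_re.tendsto _).comp (hω.tendsto_corr hLs x y _ _))).abs
  refine le_of_tendsto key ?_
  filter_upwards [hLs.eventually_ge_atTop (2 * Site.supNorm (x - y))] with j hj
  have h := abs_xxz_planarCorr_le_rpow_two n J Δ hβ (hD j) (hDg j) (Torus.proj (Ls j) x)
    (Torus.proj (Ls j) y)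
  rw [torusDist_proj_eq hj] at h
  exact h

/-- **The one-dimensional infinite-volume statement: exponential clustering.** Same setting on the
rings `ℤ/L_jℤ`: every torus-limit state satisfies
`|Re ω(ŜˣₓŜˣ_y) + Re ω(ŜʸₓŜʸ_y)| ≤ 2‖Ŝ⁺‖² exp (-|x - y|/ξ)`, `ξ = 2(16 β|J|‖Ŝ⁺‖² + 1)`.
[cite: KomaTasakiPRL1992, eq. (3), Theorem (one-dimensional case) and footnote 11] -/
theorem abs_xxz_planarCorr_torusLimit_le_exp_one (n : ℕ) (J Δ : ℝ) {β : ℝ} (hβ : 0 ≤ β)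
    {Ls : ℕ → ℕ} [∀ j, NeZero (Ls j)] (hLs : Tendsto Ls atTop atTop)
    (D : ∀ j, Op (TorusSite 1 (Ls j)) (n + 1)) (hD : ∀ j, (D j).IsHermitian)
    (hDg : ∀ j (ψ : TorusSite 1 (Ls j) → ℝ), ((Matrix.diagonal fun σ : TensorIndex _ (n + 1) =>
      ((Real.exp (-(∑ u, (ψ) u * ((σ u : ℕ) : ℝ))) : ℝ) : ℂ)) : Op (TorusSite 1 (Ls j)) (n + 1)) * D j *
      (Matrix.diagonal fun σ : TensorIndex _ (n + 1) =>
      ((Real.exp (-(∑ u, (-ψ) u * ((σ u : ℕ) : ℝ))) : ℝ) : ℂ)) = D j)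
    {ω : InfVolState 1 (n + 1)}
    (hω : ω.IsTorusLimitOf (fun j => gibbsState β (xxzHamiltonian n (torusGraph 1 (Ls j)) J Δ + D j)))
    (x y : Site 1) :
    |(ω.corr x y (spinVec n 0) (spinVec n 0)).re + (ω.corr x y (spinVec n 1) (spinVec n 1)).re| ≤
      2 * (‖spinRaise n‖ * ‖spinRaise n‖) *
        Real.exp (-(1 / (16 * (β * (|J| * (‖spinRaise n‖ * ‖spinRaise n‖))) + 1) / 2 *
          (Site.supNorm (x - y) : ℝ))) := by
  have key : Tendsto (fun j =>
      |(gibbsState β (xxzHamiltonian n (torusGraph 1 (Ls j)) J Δ + D j)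
          (onSite (Torus.proj (Ls j) x) (spinVec n 0) * onSite (Torus.proj (Ls j) y) (spinVec n 0))).re +
        (gibbsState β (xxzHamiltonian n (torusGraph 1 (Ls j)) J Δ + D j)
          (onSite (Torus.proj (Ls j) x) (spinVec n 1) * onSite (Torus.proj (Ls j) y) (spinVec n 1))).re|)
      atTop (𝓝 |(ω.corr x y (spinVec n 0) (spinVec n 0)).re +
        (ω.corr x y (spinVec n 1) (spinVec n 1)).re|) :=
    (((Complex.continuous_re.tendsto _).comp (hω.tendsto_corr hLs x y _ _)).add
      ((Complex.continuous_re.tendsto _).comp (hω.tendsto_corr hLs x y _ _))).abs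
  refine le_of_tendsto key ?_
  filter_upwards [hLs.eventually_ge_atTop (2 * Site.supNorm (x - y))] with j hj
  have h := abs_xxz_planarCorr_le_exp_one n J Δ hβ (hD j) (hDg j) (Torus.proj (Ls j) x)
    (Torus.proj (Ls j) y)
  rw [torusDist_proj_eq hj] at h
  exact h

/-- **No off-diagonal long-range order of hard-core lattice bosons in the plane, infinite volume.**
For every staggered field `λ`, every `β ≥ 0`, every sequence of sides `L_j → ∞` and every
thermodynamic-limit state `ω` of the Gibbs states of `hardCoreLatticeGas 2 L_j λ`, the one-particle
density matrix `γ(x,y) = Re ω(S¹_xS¹_y) + Re ω(S²_xS²_y)` (= `ω(a†_x a_y)` for the real states at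
hand) decays at least like `|γ(x,y)| ≤ 2 e^{1/2} (‖x - y‖_∞ + 1)^{-1/(2(128 β + 1))}`; in particular
`γ(x,y) → 0` as `‖x - y‖ → ∞`: no off-diagonal long-range order in the sense of Penrose–Onsager /
Yang in any infinite-volume torus-limit Gibbs state of the planar hard-core Bose gas at `T > 0`.
[cite: KomaTasakiPRL1992, eq. (3), bound (4) and footnote 11] [cite: AizenmanEtAl2004, Theorem 1
(the `d ≥ 3` contrast)] -/
theorem hardCoreLatticeGas_odlro_torusLimit_abs_le_rpow_two (lam : ℝ) {β : ℝ} (hβ : 0 ≤ β)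
    {Ls : ℕ → ℕ} [∀ j, NeZero (Ls j)] (hLs : Tendsto Ls atTop atTop) {ω : InfVolState 2 2}
    (hω : ω.IsTorusLimitOf (fun j => gibbsState β (hardCoreLatticeGas 2 (Ls j) lam)))
    (x y : Site 2) :
    |(ω.corr x y (spinVec 1 0) (spinVec 1 0)).re + (ω.corr x y (spinVec 1 1) (spinVec 1 1)).re| ≤
      2 * Real.exp (1 / 2) * ((Site.supNorm (x - y) : ℝ) + 1) ^ (-(1 / (128 * β + 1) / 2)) := by
  have key : Tendsto (fun j =>
      |(gibbsState β (hardCoreLatticeGas 2 (Ls j) lam)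
          (onSite (Torus.proj (Ls j) x) (spinVec 1 0) * onSite (Torus.proj (Ls j) y) (spinVec 1 0))).re +
        (gibbsState β (hardCoreLatticeGas 2 (Ls j) lam)
          (onSite (Torus.proj (Ls j) x) (spinVec 1 1) * onSite (Torus.proj (Ls j) y) (spinVec 1 1))).re|)
      atTop (𝓝 |(ω.corr x y (spinVec 1 0) (spinVec 1 0)).re +
        (ω.corr x y (spinVec 1 1) (spinVec 1 1)).re|) :=
    (((Complex.continuous_re.tendsto _).comp (hω.tendsto_corr hLs x y _ _)).add
      ((Complex.continuous_re.tendsto _).comp (hω.tendsto_corr hLs x y _ _))).abs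
  refine le_of_tendsto key ?_
  filter_upwards [hLs.eventually_ge_atTop (2 * Site.supNorm (x - y))] with j hj
  have h := hardCoreLatticeGas_odlro_abs_le_rpow_two lam hβ (Ls j) (Torus.proj (Ls j) x)
    (Torus.proj (Ls j) y)
  rw [hardCoreODLRO_eq_re_add, torusDist_proj_eq hj] at h
  exact h

/-- **The quantum XY model in the plane, infinite volume**: for every spin `n/2`, every `β ≥ 0`
and every torus-limit state `ω` of the Gibbs states of `xyTorus 2 L_j n` (`L_j → ∞`),
`|Re ω(ŜˣₓŜˣ_y) + Re ω(ŜʸₓŜʸ_y)| ≤ 2‖Ŝ⁺‖² e^{1/2} (‖x - y‖_∞ + 1)^{-q/2}`, `q = 1/(128 β‖Ŝ⁺‖² + 1)`: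
no planar long-range order in any infinite-volume torus-limit Gibbs state at `T > 0`.
[cite: KomaTasakiPRL1992, eq. (3), bound (4) and footnote 11] -/
theorem xy_thermal_torusLimit_abs_corr_le_rpow_two (n : ℕ) {β : ℝ} (hβ : 0 ≤ β)
    {Ls : ℕ → ℕ} [∀ j, NeZero (Ls j)] (hLs : Tendsto Ls atTop atTop) {ω : InfVolState 2 (n + 1)}
    (hω : ω.IsTorusLimitOf (fun j => gibbsState β (xyTorus 2 (Ls j) n))) (x y : Site 2) :
    |(ω.corr x y (spinVec n 0) (spinVec n 0)).re + (ω.corr x y (spinVec n 1) (spinVec n 1)).re| ≤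
      2 * (‖spinRaise n‖ * ‖spinRaise n‖) * Real.exp (1 / 2) *
        ((Site.supNorm (x - y) : ℝ) + 1) ^
          (-(1 / (128 * (β * (‖spinRaise n‖ * ‖spinRaise n‖)) + 1) / 2)) := by
  have hω' : ω.IsTorusLimitOf
      (fun j => gibbsState β (xxzHamiltonian n (torusGraph 2 (Ls j)) (-1) 0 + 0)) := by
    simpa only [add_zero] using hω
  have h := abs_xxz_planarCorr_torusLimit_le_rpow_two n (-1) 0 hβ hLs (fun _ => 0)
    (fun _ => isHermitian_zero) (fun _ ψ => by rw [Matrix.mul_zero, Matrix.zero_mul]) hω' x y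
  rwa [abs_neg, abs_one, one_mul] at h

/-- **The quantum XY chain, infinite volume**: exponential clustering
`|Re ω(ŜˣₓŜˣ_y) + Re ω(ŜʸₓŜʸ_y)| ≤ 2‖Ŝ⁺‖² exp (-|x - y|/ξ)`, `ξ = 2(16 β‖Ŝ⁺‖² + 1)`, in every
torus-limit state of the Gibbs states of `xyTorus 1 L_j n` at `β ≥ 0`.
[cite: KomaTasakiPRL1992, eq. (3), Theorem (one-dimensional case) and footnote 11] -/
theorem xy_thermal_torusLimit_abs_corr_le_exp_one (n : ℕ) {β : ℝ} (hβ : 0 ≤ β)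
    {Ls : ℕ → ℕ} [∀ j, NeZero (Ls j)] (hLs : Tendsto Ls atTop atTop) {ω : InfVolState 1 (n + 1)}
    (hω : ω.IsTorusLimitOf (fun j => gibbsState β (xyTorus 1 (Ls j) n))) (x y : Site 1) :
    |(ω.corr x y (spinVec n 0) (spinVec n 0)).re + (ω.corr x y (spinVec n 1) (spinVec n 1)).re| ≤
      2 * (‖spinRaise n‖ * ‖spinRaise n‖) *
        Real.exp (-(1 / (16 * (β * (‖spinRaise n‖ * ‖spinRaise n‖)) + 1) / 2 *
          (Site.supNorm (x - y) : ℝ))) := by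
  have hω' : ω.IsTorusLimitOf
      (fun j => gibbsState β (xxzHamiltonian n (torusGraph 1 (Ls j)) (-1) 0 + 0)) := by
    simpa only [add_zero] using hω
  have h := abs_xxz_planarCorr_torusLimit_le_exp_one n (-1) 0 hβ hLs (fun _ => 0)
    (fun _ => isHermitian_zero) (fun _ ψ => by rw [Matrix.mul_zero, Matrix.zero_mul]) hω' x y
  rwa [abs_neg, abs_one, one_mul] at h

/-- **Hard-core lattice bosons on the infinite chain, `T > 0`: exponential clustering of the
one-particle density matrix** in every torus-limit state of the Gibbs states of
`hardCoreLatticeGas 1 L_j λ`: `|γ(x,y)| ≤ 2 exp (-|x - y|/(2(16β + 1)))`, every `λ`, every `β ≥ 0`.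
[cite: KomaTasakiPRL1992, eq. (3), Theorem (one-dimensional case) and footnote 11] -/
theorem hardCoreLatticeGas_odlro_torusLimit_abs_le_exp_one (lam : ℝ) {β : ℝ} (hβ : 0 ≤ β)
    {Ls : ℕ → ℕ} [∀ j, NeZero (Ls j)] (hLs : Tendsto Ls atTop atTop) {ω : InfVolState 1 2}
    (hω : ω.IsTorusLimitOf (fun j => gibbsState β (hardCoreLatticeGas 1 (Ls j) lam)))
    (x y : Site 1) :
    |(ω.corr x y (spinVec 1 0) (spinVec 1 0)).re + (ω.corr x y (spinVec 1 1) (spinVec 1 1)).re| ≤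
      2 * Real.exp (-(1 / (16 * β + 1) / 2 * (Site.supNorm (x - y) : ℝ))) := by
  have key : Tendsto (fun j =>
      |(gibbsState β (hardCoreLatticeGas 1 (Ls j) lam)
          (onSite (Torus.proj (Ls j) x) (spinVec 1 0) * onSite (Torus.proj (Ls j) y) (spinVec 1 0))).re +
        (gibbsState β (hardCoreLatticeGas 1 (Ls j) lam)
          (onSite (Torus.proj (Ls j) x) (spinVec 1 1) * onSite (Torus.proj (Ls j) y) (spinVec 1 1))).re|)
      atTop (𝓝 |(ω.corr x y (spinVec 1 0) (spinVec 1 0)).re +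
        (ω.corr x y (spinVec 1 1) (spinVec 1 1)).re|) :=
    (((Complex.continuous_re.tendsto _).comp (hω.tendsto_corr hLs x y _ _)).add
      ((Complex.continuous_re.tendsto _).comp (hω.tendsto_corr hLs x y _ _))).abs
  refine le_of_tendsto key ?_
  filter_upwards [hLs.eventually_ge_atTop (2 * Site.supNorm (x - y))] with j hj
  have h := hardCoreLatticeGas_odlro_abs_le_exp_one lam hβ (Ls j) (Torus.proj (Ls j) x)
    (Torus.proj (Ls j) y)
  rw [hardCoreODLRO_eq_re_add, torusDist_proj_eq hj] at h
  exact h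

end InfiniteVolume

end Literature.MathematicalPhysics.QuantumLattice.MerminWagner
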